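import Literature.MathematicalPhysics.QuantumFieldTheory.Balaban1983to89.T4ShellCount

/-!
# `Balaban1983to89.T4LipschitzCutoff` — design (η) of the count × suppression route to NE7c, PRICED IN THE KERNEL:
Lipschitz cut-off profiles instead of sharp characteristic functions, the min-refinement of the core/shell split, the
VALUE-small mismatch bound, the printed-ladder admissibility condition, and the constructor of the literal
`T4IndicatorShell.ShellWeightBound` from single-run inputs plus the two-run width alone (cell `pub-balaban`, T4-DAG
§6 NE7c / §5 row T4-U5b.E2; records `t4/T4-EST-NE7c-P2.md` (this lineage: v1 §3 names (η) as the one design under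
which count × suppression closes; v1.1 prices it), `t4/T4-EST-U5bE2.md` v1.2 §0(c)–(d) (designs (i), (ii′)); kernel
siblings `T4ShellCount` (the route, its wall `not_summable_ageWeight_of_ageOnly`, the typed missing inequality
`LevelGain`, the exact booking total `tsum_bandMajorant`), `T4IndicatorShell` (target structure, sharp indicators,
design (i)'s split `prod_eq_core_add_sum_shell`), `T4NestedShells` §4 (`shellWeightBound_of_levels`), `T4ShellMeasure`
(the sibling SHELL-MEASURE route, whose anti-concentration input (M1) this design does NOT use)).

HONEST FRAMING (cell `pub-balaban`, T4-DAG PAGE 1).  The cell's T4 target is rung (B)+1: existence AND uniqueness of the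
`ε → 0` limit of Bałaban's unit-scale averaged loop expectations on a FIXED finite torus — strictly beyond ultraviolet
stability (B), conditional on the named spine estimates, and NOT infinite volume, NOT a mass gap, NOT reflection
positivity of a limit, NOT the Clay problem.  This file is [folklore] real analysis and bookkeeping about numbers in
`[0, 1]`; it proves no estimate of the programme, and every analytic input below is an explicit, NAMED hypothesis shape
labelled PRINTED SHAPE / NOT PRINTED.  DESIGN (η) IS A NON-PRINTED PROCEDURE: Bałaban's papers use sharp characteristic
functions throughout; replacing them by Lipschitz profiles means BOTH runs execute a modified procedure, and every
single-run bound the spine consumes (B14 Theorems 1–3, B15/B16 the R operation, B16 Theorem 1, E2) is then OWED A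
RE-READ under the modified cut-offs — that re-read is the PRICE of (η); this file isolates the part of the price that is
pure arithmetic (§2 sandwich: every support statement survives with the threshold lowered by the factor `1 − κ`; §4
ladder: the printed "are equal to 1" steps survive iff `κ` is below the printed ladder gap) and leaves the rest as a
located list in the record (`t4/T4-EST-NE7c-P2.md` v1.1 §6).  Nothing here is a claim that the modified procedure has
been carried out in print or by the cell.

ABSOLUTE RULE honoured: no internally-minted statement enters as a cited fact; the manuscripts under audit are quoted
only for what they print, never for a disputed step; programme-internal claims are never cited.

WHAT DESIGN (η) IS, AND WHY IT IS THE COUNT × SUPPRESSION ROUTE'S OWN REPAIR (not the sibling routes').  `T4ShellCount`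
proved the route WALLED: with sharp indicators the shell piece of a slot is `1[(1 − ρ)θ ≤ u < θ] ≤ 1[u ≥ (1 − ρ)θ]` —
small in SUPPORT only, so its single-run weight is an AGE-only number (lowered-threshold suppression, NE7b species) and
`Σ_K Wsh_K` diverges at the final-scale slot (`T4ShellCount.not_summable_ageWeight_of_ageOnly`); the missing input was
typed as `T4ShellCount.LevelGain` — a factor `y(K − a)` summable over LEVELS.  The sibling SHELL-MEASURE route buys `y`
from the law of `u` (anti-concentration, `T4ShellMeasure` (M1)); the two-currency route re-books (`T4ShellSuppression
Route`).  Design (η) buys it from NOTHING BUT THE TWO-RUN WIDTH: if the slot factor is `χ(u/θ)` with `χ` Lipschitz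
(constant `L`, `χ = 1` below `1 − κ`, `χ = 0` above `1`), then the two runs' factors differ in VALUE by at most
`L · |u^A − u^B|/θ ≤ L · ρ_j` ((F∞) at the slot's level `j`), and the difference is supported where `u^A ≥ (1 − κ − ρ_j)θ`
— a same-run large-field event at a lowered threshold (§2 `profile_sub_min_le`).  So the per-slot ratio factorises as
`x a K ≤ (L · S(a)) · ρ_{K − a}` — `T4ShellCount.LevelGain` with `y = ρ`, deterministic, no law of `u` — and the
constructor §3 delivers the literal `ShellWeightBound` with the EXACT total `C₀(n, L·S) · Σ_j ρ_j` (§3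
`tsum_weight_eq`).  The refinement of design (i) that makes this work is the MIN-CORE (§1): split `∏ pᵢ = ∏ min(pᵢ, qᵢ)
+ Σᵢ pieces` with the common, symmetric `[0, 1]`-valued core `∏ min(pᵢ, qᵢ)` (identical in both runs — a common factor
is sandwiched with constants `(0, 0)`, so node U5b's per-factor sandwich `T4RecentScale.FactorSandwich` takes it as is)
and mismatch factors `pᵢ − min(pᵢ, qᵢ) = (pᵢ − qᵢ)₊`, small in VALUE; for `{0, 1}`-valued factors it IS design (i)
(§1 `minPiece_eq_shellPiece_of_indicator`).  (Using design (i)'s mismatch `pᵢ(1 − qᵢ)` with smooth profiles would NOT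
do: it is supported on the whole transition layer of relative width `κ`, not `ρ_j`.)

THE PRINTED LADDER AND THE ADMISSIBILITY OF `κ` (§4; the one place where the arithmetic of (η) meets a printed number).
[Balaban1989LargeFieldI] T. Bałaban, *Large field renormalization. I. The basic step of the R operation*, Commun.
Math. Phys. 122 (1989) 175–202 (render stem `1989-cmp122-large-field-I`, PDF page = journal page − 174; pp. 181–182
read by this seat on the rendered page images):  p. 181 «We follow the procedure of Sect. 3 [III], so we introduce at
first new characteristic functions in such a way that the function restricting the fluctuation field does not depend
on the background field. We start with the decomposition of unity 1 = χ_k^{(0)} + (1 − χ_k^{(0)}), where» (1.22)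
`χ_k^{(0)} = χ({|U^{(0)}_{k,Z}(∂p) − 1| < (1 − β½)ε_h(L^{k−h}η)² for p ∈ Ω_h∖Ω_{h+1}})`; «In components with the
function 1 − χ_k^{(0)} we have introduced new large fields, therefore they do not satisfy the condition (ii), and we
exclude them from the region Z.»; «The restrictions in the function (1.22) imply that the characteristic functions
(1.3) for j = h and □ ⊂ (Ω~_{h+1})ᶜ∖Z_h are equal to 1. Thus the function χ_h(Ω_h∖Ω~_{h+1}) in (1.2) is replaced by
χ_k^{(0)}χ_h(Z_h∩Ω_h).» — THE LADDER STEP: a STRONGER restriction (threshold lowered by the factor `1 − β½`) makes the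
weaker characteristic function IDENTICALLY 1 on its support, so it is dropped; (1.23) the next rung
`(1 − β(½ + 1/2²))`; p. 181 bottom «some integration regions overlap, more exactly the regions with indices greater
than k₀, and for these we change the regularity conditions by a factor, which is a power of some number, the power
being proportional to a number of overlapping regions» [CORRECTION-2 (v1.2), finding F2: in print this sentence
describes the factors `L₀^{2max{0,i−k₀−1}}` of (1.24)/(1.49) — the «number» is `L₀`, p. 182 «The number L₀ satisfies
2 ≤ L₀ < ½L» — and NOT the dyadic exponents of the `β`-rungs, which are present already in the disjoint case
(1.22)–(1.23) and count the integrations since the region's level; design (η) leaves the `L₀` factors untouched: they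
are common to the old and the new condition of the same region and divide out of every rung step, cf. §5
`rung_step_displayed`], the general rung `(1 − β(1 − 2^{−(j−h+1)}))ε_h(L^{k−h}η)²`;
p. 182, after (1.24): «where c = 1 for j < k, and c = 3 for j = k. We choose the number β satisfying 0 < β ≤ 1/2, but
not too small, e.g., we can take β = 1/2.»  With profiles of transition width `κ` (relative), the ladder step needs
`θ_strong ≤ (1 − κ)θ_weak` (§2 `profile_eq_one_of_ladder`); consecutive printed rungs `r_m = 1 − β(1 − 2^{−m})` differ
by `β2^{−(m+1)}` (§4 `rung_sub_rung_succ`), so — AT THE LEVEL OF BARE THRESHOLDS — `κ ≤ β2^{−(M+1)}` is admissible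
for all rungs `m ≤ M` (§4 `rung_succ_le_of_kappa_le`; but see the CORRECTION below and §5: the printed «equal to 1»
steps are regularity CHAINS, and the binding quantity is each chain's RESIDUAL slack), `M + 1` = the largest exponent
on the ladder at the slot [CORRECTION-2 (v1.2), replacing v1/v1.1's «M ≤ N₀ + 1», a misreading of the RANGE of (1.24) —
cell cross-read of this file, finding F1]: the FIRST line of (1.24) (p. 181 bottom) is the region `Z″_{h+1} ∩ Ω_h` with
exponent `j − h + 1`, and (1.49) p. 186 states the rung for `Z″_{i+1}∖Z″_i` «for i = h, h + 1,…,j − 1» with exponent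
`j − i + 1`, where `h = k − N` ((1.11) p. 179; (1.2) p. 178 «where h = k − N»); so at integration index `j` the exponents
run from `2` up to `j − h + 1 ≤ N + 1`, i.e. `M ≤ N` = the LIVE WINDOW (p. 179 «Take the smallest positive integer N₀
such, that L^{−N₀+1}MR_{k−N₀+1} = M. … We assume that N > N₀, in fact it will become clear later that N is much greater
than N₀»; the `k₀ = k − N₀` lines of (1.24) on p. 182, exponents `2^{−(j−k₀+1)}, …, 2^{−2}, ½`, are the YOUNG regions
`i > k₀`, which carry the small exponents and the extra factors `L₀^{2max{0,i−k₀−1}}`; the OLD regions `h ≤ i ≤ k₀`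
carry the large exponents), INSIDE the live window; the Lipschitz constant is then `L = κ^{−1} ≥ 2^{M+1}/β`
(§2 `linProfile` realises `L = κ^{−1}`; §2 `LipProfile.inv_kappa_le` shows no profile does better; §4
`L_ge_of_admissible`), an AGE-only number that joins the cube-count entropy inside `C₀` — paid once (§3), never per `K`:
for a slot of AGE `a` the relevant old exponent is `a + 1`, so under §5 `L_χ(a) = 2^{a+O(1)}/β²` — exactly the
age-indexed `Lχ : ℕ → ℝ` that §3 carries — and uniformly over the window `L_χ = 2^{N+O(1)}/β²` (NOT `2^{N₀+O(1)}/β²` as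
v1/v1.1 booked); `K`-uniformity is untouched, since ages are capped by `N` (`range (N + 1)` in §3 `lipWeight`/`C0`).
HOW PRINT TIES `N` TO THE COUPLING (located, v1.2; p. 198 read as an image by this seat): after (1.94) «The last
inequality holds under two restrictions on N. At first, we assume that N ≤ O(1)(log g_k^{−2})^ν ≤ O(1)(1 +
β₀)(log g_h^{−2})^ν with a positive integer ν satisfying (1/2)ν ≤ p₀ − p₁ − 1. The second is that N has to be
sufficiently large, so that the constant in the second term above can be bounded by (1/2)α. These two conditions can be
satisfied by N to the positive power of log g_k^{−2}.», together with p. 192 «N₀ = O(log g_k^{−2})» and p. 179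
«N > N₀».  So `2^N = exp(N log 2)` is NOT a power of `log g_k^{−1}`: at the LOWER end of print's latitude
(`N ≍ log g_k^{−2}`) it is a power `g_k^{−O(1)}`, which the super-polynomial large-field factor `exp(−p₀(g))`,
`p₀(g) = A₀(log g^{−2})^{p₀}` ([Balaban1988Convergent] p. 246; the tree's `p0Profile`), still absorbs for `g_k` small;
at the UPPER end (`N ≍ (log g_k^{−2})^ν`) it is `exp(O(1)(log g_k^{−2})^ν)`, which one factor `exp(−p₀(g))` absorbs
only if `ν < p₀` — a condition print neither states nor needs (print's procedure has no factor `2^N`).  Whether the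
spine may take `N` at the lower end is a question about every OTHER printed restriction on `N` in [IV]/[V], not read
here; this file's theorems are over an abstract `M` and abstract `Lχ : ℕ → ℝ` and do not depend on the answer.
[CLOSED FROM PRINT (v1.3; pages read as images by this seat): [Balaban1989LargeFieldII] p. 361 «We have assumed here
that N ≤ R_k», p. 384 «with N = R_j», p. 386 «hence K = R_{j+1}»; [Balaban1988Convergent] p. 246 «R₁ is the smallest
power of L such, that R₁ ≥ (log g₁^{−2})^r» and «p₀ ≥ 5r», (2.5) p. 255 «R_j is the smallest number of the form L^r
such, that R_j ≥ (log g_j^{−2})^r».  So `N ≤ R_k < L(log g_k^{−2})^r` with `r ≤ p₀/5 < p₀`, and `2^{N+O(1)} ≤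
O(1)exp((log 2)L(log g_k^{−2})^r) ≤ exp(ϑ·p₀(g_k))` for every `ϑ > 0` once `g_k ≤ g(ϑ)`: the Lipschitz price costs an
arbitrarily small fraction of ONE exponent `p₀(g_k) = A₀(log g_k^{−2})^{p₀}` — the arithmetic is §7
`strictExponent_absorbs` with the exponents `r < p₀`.]
CORRECTION (v1.1, after reading pp. 183–187 as images; §1–§4 unchanged).  The «equal to 1» steps are proved in print
through the identity (1.29) p. 183 and regularity chains that consume part of each gap: (1.31) p. 184 leaves the factor
`1 − β/10 + (β/5)L^{−2}` for the step (1.22) ⇒ (1.3) (§5 `slack131`, `step131_admissible`: `κ ≤ β/10 − (β/5)L^{−2}`);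
the rung step (1.48)–(1.50) pp. 186–187 leaves, as DISPLAYED, `(1 − 8α)β2^{−(j−i+2)}` and print takes «α = 1/8» —
zero displayed residual (§5 `rung_step_displayed`, `displayed_residual_zero`) — while the chain (1.48) itself retains
`β2^{−(j−i+2)}(1 − 4α(1 + r_{j−i+2})) ≥ (3/8)β·β2^{−(j−i+2)}` at `α = 1/8` (§5 `rung_step_exact_residual`,
`printed_alpha_residual_ge`).  So, with NO printed constant re-chosen, `κ ≤ min(β/10 − (β/5)L^{−2}, (3/8)β²2^{−(M+2)})`
serves the chains read by this seat (§5 `rung_step_admissible_printed`), and re-choosing the free absolute constant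
`α < 1/8` («will be chosen later» p. 186; its source terms «can be made arbitrarily small by choosing γ, or A₁/A₀
sufficiently small») relaxes the second entry to `(1 − 8α)β2^{−(M+2)}` (§5 `rung_steps_admissible`).  The species of the
price — an AGE-only `L_χ ≥ κ^{−1}` of size `2^{M+O(1)}/β^{2}` inside `C₀` — is as stated above; chains on pages this seat
has not read are not classified by this file.
THE OTHER PRINTED LOCI THIS DESIGN TOUCHES (read by this seat on the rendered pages; they enter ONLY as the hypothesis
SHAPES `SiblingSuppression` (§3) and `T4ShellCount.CubeCount`, and as the reason for §2 `abs_sup'_sub_sup'_le` /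
`abs_inf'_sub_inf'_le`):  [Balaban1988Convergent] T. Bałaban, *Convergent renormalization expansions for lattice gauge
theories*, Commun. Math. Phys. 119 (1988) 243–285 (stem `1988-cmp119-convergent-renormalization`, PDF page = journal
page − 242), p. 257 (2.17) `χ_k(Ω_k) = ∏_{□ ⊂ Ω_k} χ({sup_{p ⊂ □~}|U_{k,□}(V_k, ∂p) − 1| < ε_kη²})` — the cube function
tests a SUPREMUM over plaquettes, and a supremum (likewise the infimum over extensions in [Balaban1989LargeFieldI]
(1.75) p. 193 `χ_{k,Λ} = χ({inf_{V_k↾Λ} sup_{p ∈ Ω^c_k}|U_{k,Z}(∂p) − 1| < 2ε_kη²})`) inherits the two-run closeness of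
each plaquette variable (§2), so the mismatch bound applies to functions of the printed form; p. 257, after (2.18):
«Basically this operation is a composition of integrations restricted to large field regions in successive scales, and
multiplications by characteristic functions, δ-functions defining renormalization transformations,».
[Balaban1989LargeFieldI] p. 193: «This condition is enough to get the exponential small factor, estimating in the
usual way the Wilson action. Thus 1 − χ_{k,Λ} is a large field function, and we exclude from Z the components with this
function.» — THE TEMPLATE of `SiblingSuppression`: a configuration in the support of a complementary function
`1 − χ` carries a LOWER bound on the field, hence the exponential small factor; under design (η) the support of
`1 − χ(u/θ)` lies in `{u ≥ (1 − κ)θ}` (§2 `one_sub_profile_le_largeInd`), so every such step survives with the threshold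
constant multiplied by `1 − κ ≥ 1 − β/4`.  [Balaban1989LargeFieldII] T. Bałaban, *Large field renormalization. II*,
Commun. Math. Phys. 122 (1989) 355–392 (stem `1989-cmp122-large-field-II`, PDF page = journal page − 354), p. 383: «We
take the bond b, for which |B(b)| ≥ g_j^{−1}δ′_j = A₁p₁(g_j), and the inequalities (1.77), (1.78) yield the following
large field factor» `exp(−½γ₀[6(d + 3)(100M(L + 1)N^{β₀}R_j)^{d+2}]^{−1}A₁²p₁(g_j)) < exp(−R_j^{−d−5}p₁²(g_j))`, «This
is the largest factor among all the small factors we have obtained from the large field characteristic functions in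
the preparatory steps. We assume that 2p₁ − (d + 5)r₀ > p₀, and we estimate the factors by exp(−p₀(g_j)).» — the
printed SLACK between the actual small factor and the booked `exp(−p₀(g_j))` is a power of `log g_j^{−1}`, so a lower
bound degraded by the constant factor `(1 − κ)²` is absorbed for `g_j` small (this is an observation about the printed
inequality's form, not a claim that the modified procedure has been carried out); (1.79) ibid. the one-run bound with
«∏′ exp(−p₀(g_j))» «where the last product is over components of Z_j satisfying the conditions (i), (ii), for which
some large fields are created during the preparatory steps» — the per-created-region factor indexed by the coupling of
the creation step, i.e. by AGE.
Unit `b2b-balaban-t4-ne7c-p2` GEN 2 (journal CLAIM T4-U5b.E2-NE7c-PROVE-P2b* 2026-08-19T07:40:04Z); v1 = p184896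
(80138bb70a8c), v1.1 = header CORRECTION paragraph + §5 (§1–§4 byte-identical) = p184944 (e6919eab06d4).  GEN 3
(journal CLAIM T4-U5b.E2-NE7c-PROVE-P2c* 2026-08-19T08:34:06Z): v1.2 = DOCFIX F1/F2/F3 of the cell cross-read of v1/v1.1
(header CORRECTION-2 brackets, three docstrings; NO declaration of §1–§5 changed) + the appended §6 (advisories A1–A3
of the same cross-read as lemmas: the shell-restricted per-term bound, the large-field-slot pair, the chain (1.52));
v1.3 (same claim) = one header bracket (the `N`-versus-coupling question closed from print) + the appended §7 (the (η)
RE-READ census the owner's verdict asks for: the remaining located «equal to 1» chains (3.8), (1.96), (1.98), the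
`2δ`-chains and the free-constant chains as admissibility lemmas, the L-class lowering and its absorption, the one
located class-D locus — on sharp-kept functions — with an advisory); NO declaration of §1–§6 changed.
[folklore arithmetic]
-/

noncomputable section

open Finset _root_.Filter _root_.Topology

namespace Literature.MathematicalPhysics.QuantumFieldTheory.Balaban1983to89.T4LipschitzCutoff

open T4IndicatorShell T4NestedShells T4ShellCount

/-! ## §1 The min-refinement of design (i): a common `[0,1]`-valued core and VALUE-small mismatch pieces -/

section MinCore

/-- The `i`-th MIN-PIECE of a product `∏_{i' < n} p i'` relative to core factors `c` (intended `c i = min (p i) (q i)`,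
`q` = the other run's factors): core factors before `i`, the mismatch `p i − c i` at `i`, the run's own factors after
`i` (same telescoping as `T4IndicatorShell.shellPiece`, with a general core). (bookkeeping shape) [folklore] -/
def minPiece (p c : ℕ → ℝ) (n i : ℕ) : ℝ :=
  (∏ i' ∈ range i, c i') * (p i - c i) * ∏ i' ∈ Ico (i + 1) n, p i'

/-- The run's product with slot `i`'s factor REMOVED — the slot-`i` SIBLING of the term (what a min-piece is charged
against: the term with the slot's small-field factor replaced by a large-field indicator, §2). [folklore] -/
def sibling (p : ℕ → ℝ) (n i : ℕ) : ℝ :=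
  (∏ i' ∈ range i, p i') * ∏ i' ∈ Ico (i + 1) n, p i'

/-- **THE MIN-CORE SPLIT (exact identity, any reals).**  `∏_{i<n} pᵢ = ∏_{i<n} cᵢ + Σ_{i<n} minPieceᵢ`. [folklore] -/
theorem prod_eq_prod_core_add_sum_minPiece (p c : ℕ → ℝ) (n : ℕ) :
    ∏ i ∈ range n, p i = ∏ i ∈ range n, c i + ∑ i ∈ range n, minPiece p c n i := by
  induction n with
  | zero => simp
  | succ n ih =>
    have h1 : ∀ i ∈ range n, minPiece p c (n + 1) i = minPiece p c n i * p n := by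
      intro i hi
      have hin : i + 1 ≤ n := Nat.succ_le_of_lt (mem_range.1 hi)
      simp only [minPiece]
      rw [Finset.prod_Ico_succ_top hin]
      ring
    have h2 : minPiece p c (n + 1) n = (∏ i' ∈ range n, c i') * (p n - c n) := by
      simp [minPiece]
    rw [prod_range_succ, prod_range_succ, sum_range_succ, sum_congr rfl h1, h2, ← sum_mul, ih]
    ring

/-- … equivalently the total mismatch is the difference of the two products. [folklore] -/
theorem sum_minPiece_eq (p c : ℕ → ℝ) (n : ℕ) :
    ∑ i ∈ range n, minPiece p c n i = ∏ i ∈ range n, p i - ∏ i ∈ range n, c i := by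
  rw [prod_eq_prod_core_add_sum_minPiece p c n]; ring

/-- Min-pieces of factors `0 ≤ cᵢ ≤ pᵢ` are nonnegative. [folklore] -/
theorem minPiece_nonneg {p c : ℕ → ℝ} {n : ℕ} (hc : ∀ i < n, 0 ≤ c i) (hcp : ∀ i < n, c i ≤ p i) {i : ℕ}
    (hi : i < n) : 0 ≤ minPiece p c n i := by
  unfold minPiece
  refine mul_nonneg (mul_nonneg ?_ (sub_nonneg.2 (hcp i hi))) ?_
  · exact prod_nonneg fun i' hi' => hc i' ((mem_range.1 hi').trans hi)
  · exact prod_nonneg fun i' hi' => (hc i' (mem_Ico.1 hi').2).trans (hcp i' (mem_Ico.1 hi').2)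

/-- The total mismatch of factors `0 ≤ cᵢ ≤ pᵢ` is at most the run's own product (the core is nonnegative). [folklore] -/
theorem sum_minPiece_le_prod {p c : ℕ → ℝ} {n : ℕ} (hc : ∀ i < n, 0 ≤ c i) :
    ∑ i ∈ range n, minPiece p c n i ≤ ∏ i ∈ range n, p i := by
  rw [sum_minPiece_eq]
  exact sub_le_self _ (prod_nonneg fun i hi => hc i (mem_range.1 hi))

/-- **TERM DOMINATION BY THE SIBLING.**  For `0 ≤ cᵢ ≤ pᵢ` and a nonnegative remainder `R` (the term's other factors),
`minPieceᵢ · R ≤ (pᵢ − cᵢ) · siblingᵢ · R`: the piece is charged against the term with slot `i`'s factor removed, times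
the VALUE of the mismatch — contrast `T4IndicatorShell.shellPiece_mul_le_shell_mul_term`, where a sharp mismatch is an
indicator and the piece is charged against the term itself on a SUPPORT. [folklore] -/
theorem minPiece_mul_le {p c : ℕ → ℝ} {n : ℕ} (hc : ∀ i < n, 0 ≤ c i) (hcp : ∀ i < n, c i ≤ p i) {i : ℕ}
    (hi : i < n) {R : ℝ} (hR : 0 ≤ R) : minPiece p c n i * R ≤ (p i - c i) * sibling p n i * R := by
  refine mul_le_mul_of_nonneg_right ?_ hR
  unfold minPiece sibling
  have hmid : 0 ≤ p i - c i := sub_nonneg.2 (hcp i hi)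
  have htail : 0 ≤ ∏ i' ∈ Ico (i + 1) n, p i' :=
    prod_nonneg fun i' hi' => (hc i' (mem_Ico.1 hi').2).trans (hcp i' (mem_Ico.1 hi').2)
  have hhead : ∏ i' ∈ range i, c i' ≤ ∏ i' ∈ range i, p i' :=
    prod_le_prod (fun i' hi' => hc i' ((mem_range.1 hi').trans hi))
      fun i' hi' => hcp i' ((mem_range.1 hi').trans hi)
  calc (∏ i' ∈ range i, c i') * (p i - c i) * ∏ i' ∈ Ico (i + 1) n, p i'
      ≤ (∏ i' ∈ range i, p i') * (p i - c i) * ∏ i' ∈ Ico (i + 1) n, p i' :=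
        mul_le_mul_of_nonneg_right (mul_le_mul_of_nonneg_right hhead hmid) htail
    _ = (p i - c i) * ((∏ i' ∈ range i, p i') * ∏ i' ∈ Ico (i + 1) n, p i') := by ring

/-- The sibling of factors in `[0, 1]` is in `[0, 1]`. [folklore] -/
theorem sibling_nonneg {p : ℕ → ℝ} {n i : ℕ} (hp : ∀ i < n, 0 ≤ p i) (hi : i < n) : 0 ≤ sibling p n i :=
  mul_nonneg (prod_nonneg fun i' hi' => hp i' ((mem_range.1 hi').trans hi))
    (prod_nonneg fun i' hi' => hp i' (mem_Ico.1 hi').2)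

/-- THE CORE IS SYMMETRIC: with `cᵢ = min(pᵢ, qᵢ)` the two runs have the SAME core (a common factor of both densities;
for node U5b's `T4RecentScale.FactorSandwich` a common nonnegative factor is sandwiched with constants `c = r = 0`,
§1 `common_factor_sandwich`). [folklore] -/
theorem prod_min_comm (p q : ℕ → ℝ) (n : ℕ) :
    ∏ i ∈ range n, min (p i) (q i) = ∏ i ∈ range n, min (q i) (p i) :=
  prod_congr rfl fun _ _ => min_comm _ _

/-- A common nonnegative factor is sandwiched between itself with log-constant `0` and radius `0` (the shape of one
factor of `T4RecentScale.FactorSandwich`). [folklore] -/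
theorem common_factor_sandwich {w : ℝ} (hw : 0 ≤ w) :
    0 ≤ w ∧ Real.exp (0 - 0) * w ≤ w ∧ w ≤ Real.exp (0 + 0) * w := by
  simp [hw]

/-- The min-core hypotheses hold for factors in `[0, 1]`: `0 ≤ min(pᵢ, qᵢ) ≤ pᵢ`. [folklore] -/
theorem min_core_bounds {p q : ℕ → ℝ} {n : ℕ} (hp : ∀ i < n, 0 ≤ p i) (hq : ∀ i < n, 0 ≤ q i) :
    (∀ i < n, 0 ≤ min (p i) (q i)) ∧ (∀ i < n, min (p i) (q i) ≤ p i) :=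
  ⟨fun i hi => le_min (hp i hi) (hq i hi), fun _ _ => min_le_left _ _⟩

/-- **REDUCTION TO DESIGN (i).**  For `{0, 1}`-valued factors `min(p, q) = p·q` and `p − min(p, q) = p·(1 − q)`, so the
min-piece IS `T4IndicatorShell.shellPiece`: the min-refinement changes nothing for sharp indicators and is a genuine
refinement only for `[0, 1]`-valued profiles. [folklore] -/
theorem min_eq_mul_of_indicator {p q : ℝ} (hp : p = 0 ∨ p = 1) (hq : q = 0 ∨ q = 1) :
    min p q = p * q ∧ p - min p q = p * (1 - q) := by
  rcases hp with rfl | rfl <;> rcases hq with rfl | rfl <;> norm_num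

/-- … hence `minPiece p (min p q) = shellPiece p q` for indicator families. [folklore] -/
theorem minPiece_eq_shellPiece_of_indicator {p q : ℕ → ℝ} {n : ℕ} (hp : ∀ i < n, p i = 0 ∨ p i = 1)
    (hq : ∀ i < n, q i = 0 ∨ q i = 1) {i : ℕ} (hi : i < n) :
    minPiece p (fun i => min (p i) (q i)) n i = shellPiece p q n i := by
  unfold minPiece shellPiece
  have hcore : ∏ i' ∈ range i, min (p i') (q i') = ∏ i' ∈ range i, p i' * q i' :=
    prod_congr rfl fun i' hi' =>
      (min_eq_mul_of_indicator (hp i' ((mem_range.1 hi').trans hi)) (hq i' ((mem_range.1 hi').trans hi))).1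
  rw [hcore, (min_eq_mul_of_indicator (hp i hi) (hq i hi)).2]

end MinCore

/-! ## §2 Lipschitz cut-off profiles: the interface, a construction, the sandwich, the mismatch bound, the ladder -/

section Profile

/-- A LIPSCHITZ CUT-OFF PROFILE of transition width `κ ∈ (0, 1)` and Lipschitz constant `L` (an INTERFACE; the
piecewise-linear `linProfile` below is an instance, so nothing is smuggled): `χ : ℝ → [0, 1]`, `χ = 1` on
`(−∞, 1 − κ]`, `χ = 0` on `[1, ∞)`, `|χ a − χ b| ≤ L|a − b|`.  The slot factor of a tested variable `u ≥ 0` with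
threshold `θ > 0` is `χ(u/θ)` — DESIGN (η), a NON-PRINTED modification of Bałaban's sharp `χ({u < θ})`. [folklore] -/
structure LipProfile (χ : ℝ → ℝ) (κ L : ℝ) : Prop where
  kappa_pos : 0 < κ
  kappa_lt_one : κ < 1
  nonneg : ∀ r, 0 ≤ χ r
  le_one : ∀ r, χ r ≤ 1
  eq_one : ∀ r, r ≤ 1 - κ → χ r = 1
  eq_zero : ∀ r, 1 ≤ r → χ r = 0
  lip : ∀ a b, |χ a - χ b| ≤ L * |a - b|

/-- The piecewise-linear profile: `1` below `1 − κ`, `0` above `1`, linear in between. [folklore] -/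
def linProfile (κ r : ℝ) : ℝ := max 0 (min 1 ((1 - r) / κ))

/-- **CONSTRUCTION.**  For `0 < κ < 1` the piecewise-linear profile is a Lipschitz cut-off profile with `L = κ⁻¹`.
[folklore] -/
theorem linProfile_lipProfile {κ : ℝ} (h0 : 0 < κ) (h1 : κ < 1) : LipProfile (linProfile κ) κ κ⁻¹ where
  kappa_pos := h0
  kappa_lt_one := h1
  nonneg := fun r => le_max_left _ _
  le_one := fun r => max_le zero_le_one (min_le_left _ _)
  eq_one := fun r hr => by
    have h : 1 ≤ (1 - r) / κ := by rw [le_div_iff₀ h0]; linarith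
    simp [linProfile, min_eq_left h]
  eq_zero := fun r hr => by
    have h : (1 - r) / κ ≤ 0 := div_nonpos_of_nonpos_of_nonneg (by linarith) h0.le
    simp [linProfile, min_eq_right (h.trans zero_le_one), max_eq_left h]
  lip := fun a b => by
    -- `r ↦ max 0 (min 1 r)` is `1`-Lipschitz (the same computation as the tree's
    -- `Literature.NumberTheory.LFunctions.PlateauMollifier.abs_clamp_sub_clamp_le`, not imported into this chain)
    have hclamp : ∀ x y : ℝ, |max 0 (min 1 x) - max 0 (min 1 y)| ≤ |x - y| := fun x y =>
      calc |max 0 (min 1 x) - max 0 (min 1 y)| ≤ max |(0 : ℝ) - 0| |min 1 x - min 1 y| :=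
            abs_max_sub_max_le_max _ _ _ _
        _ ≤ max |(0 : ℝ) - 0| (max |(1 : ℝ) - 1| |x - y|) :=
            max_le_max le_rfl (abs_min_sub_min_le_max _ _ _ _)
        _ = |x - y| := by
            rw [sub_self, sub_self, abs_zero, max_eq_right (abs_nonneg (x - y)),
              max_eq_right (abs_nonneg (x - y))]
    refine (hclamp _ _).trans (le_of_eq ?_)
    rw [← sub_div, abs_div, abs_of_pos h0, div_eq_inv_mul]
    congr 1
    rw [show (1 - a - (1 - b)) = -(a - b) by ring, abs_neg]

namespace LipProfile

variable {χ : ℝ → ℝ} {κ L : ℝ}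

/-- No profile is both narrow and gentle: `1 ≤ L·κ` (the values `1` at `1 − κ` and `0` at `1`), so `L ≥ κ⁻¹ > 0` —
the Lipschitz constant of design (η) is at least the inverse transition width. [folklore] -/
theorem one_le_L_mul_kappa (h : LipProfile χ κ L) : 1 ≤ L * κ := by
  have h1 : χ (1 - κ) = 1 := h.eq_one _ le_rfl
  have h2 : χ 1 = 0 := h.eq_zero _ le_rfl
  have := h.lip (1 - κ) 1
  rw [h1, h2, show (1 - κ - 1 : ℝ) = -κ by ring, abs_neg, abs_of_pos h.kappa_pos] at this
  simpa using this

/-- … hence `κ⁻¹ ≤ L`. [folklore] -/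
theorem inv_kappa_le (h : LipProfile χ κ L) : κ⁻¹ ≤ L := by
  rw [inv_le_iff_one_le_mul₀ h.kappa_pos]
  simpa [mul_comm] using h.one_le_L_mul_kappa

/-- … and in particular `0 < L`. [folklore] -/
theorem L_pos (h : LipProfile χ κ L) : 0 < L :=
  lt_of_lt_of_le (inv_pos.2 h.kappa_pos) h.inv_kappa_le

/-- The profile vanishes exactly when it is not positive (values in `[0, 1]`). [folklore] -/
theorem pos_of_ne_zero (h : LipProfile χ κ L) {r : ℝ} (hr : χ r ≠ 0) : 0 < χ r :=
  lt_of_le_of_ne (h.nonneg r) (Ne.symm hr)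

/-- If the profile is not zero at `r` then `r < 1`. [folklore] -/
theorem lt_one_of_ne_zero (h : LipProfile χ κ L) {r : ℝ} (hr : χ r ≠ 0) : r < 1 :=
  lt_of_not_ge fun h1 => hr (h.eq_zero r h1)

/-- **SANDWICH (support statements survive with the threshold lowered by `1 − κ`).**  For `θ > 0`:
`1[u < (1 − κ)θ] ≤ χ(u/θ) ≤ 1[u < θ]`. [folklore] -/
theorem smallInd_le_profile (h : LipProfile χ κ L) {θ : ℝ} (hθ : 0 < θ) (u : ℝ) :
    smallInd u ((1 - κ) * θ) ≤ χ (u / θ) := by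
  unfold smallInd
  split_ifs with hu
  · rw [h.eq_one _ (by rw [div_le_iff₀ hθ]; exact hu.le)]
  · exact h.nonneg _

/-- … upper half of the sandwich: `χ(u/θ) ≤ 1[u < θ]` (support statements of the type "`χ ≠ 0 ⇒ u < θ`" survive
verbatim; v1.2 DOCFIX F3: plain wording, no quotation intended). [folklore] -/
theorem profile_le_smallInd (h : LipProfile χ κ L) {θ : ℝ} (hθ : 0 < θ) (u : ℝ) :
    χ (u / θ) ≤ smallInd u θ := by
  unfold smallInd
  split_ifs with hu
  · exact h.le_one _
  · rw [h.eq_zero _ (by rw [le_div_iff₀ hθ, one_mul]; exact not_lt.1 hu)]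

/-- … and dually for the complementary (large-field) factor: `1[u ≥ θ] ≤ 1 − χ(u/θ) ≤ 1[u ≥ (1 − κ)θ]` — a
"large field function" in the sense of [Balaban1989LargeFieldI] p. 181/p. 193 at the LOWERED threshold `(1 − κ)θ`.
[folklore] -/
theorem one_sub_profile_le_largeInd (h : LipProfile χ κ L) {θ : ℝ} (hθ : 0 < θ) (u : ℝ) :
    1 - χ (u / θ) ≤ largeInd u ((1 - κ) * θ) := by
  unfold largeInd
  split_ifs with hu
  · linarith [h.nonneg (u / θ)]
  · rw [h.eq_one _ (by rw [div_le_iff₀ hθ]; exact (not_le.1 hu).le), sub_self]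

/-- … and `1[u ≥ θ] ≤ 1 − χ(u/θ)`. [folklore] -/
theorem largeInd_le_one_sub_profile (h : LipProfile χ κ L) {θ : ℝ} (hθ : 0 < θ) (u : ℝ) :
    largeInd u θ ≤ 1 - χ (u / θ) := by
  unfold largeInd
  split_ifs with hu
  · rw [h.eq_zero _ (by rwa [le_div_iff₀ hθ, one_mul]), sub_zero]
  · linarith [h.le_one (u / θ)]

/-- **THE VALUE OF THE MISMATCH (two-run closeness ⇒ closeness of the factors).**  For `θ > 0` and
`|u^A − u^B| ≤ Δ`: `|χ(u^A/θ) − χ(u^B/θ)| ≤ L · Δ/θ` — with `Δ = ρ_j θ` ((F∞) in relative form) this is `L ρ_j`, a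
LEVEL-indexed number. [folklore] -/
theorem abs_profile_sub_profile_le (h : LipProfile χ κ L) {θ : ℝ} (hθ : 0 < θ) {uA uB Δ : ℝ}
    (hΔ : |uA - uB| ≤ Δ) : |χ (uA / θ) - χ (uB / θ)| ≤ L * (Δ / θ) := by
  refine (h.lip _ _).trans ?_
  rw [← sub_div, abs_div, abs_of_pos hθ]
  exact mul_le_mul_of_nonneg_left (div_le_div_of_nonneg_right hΔ hθ.le) h.L_pos.le

/-- **THE FACTORISED MISMATCH BOUND (the heart of design (η)).**  For `θ > 0`, `|u^A − u^B| ≤ Δ`: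
`χ(u^A/θ) − min(χ(u^A/θ), χ(u^B/θ)) ≤ (L · Δ/θ) · 1[u^A ≥ (1 − κ)θ − Δ]` — the slot's mismatch factor is the LEVEL GAIN
`L Δ/θ` times a SAME-RUN large-field indicator at a lowered threshold (no object of run B survives on the right: a
single-run quantity, as NE7c requires; its weight relative to the run is the NE7b-species `SiblingSuppression`, §3).
If `u^A < (1 − κ)θ − Δ` then `u^B < (1 − κ)θ`, both factors equal `1`, and there is no mismatch. [folklore] -/
theorem profile_sub_min_le (h : LipProfile χ κ L) {θ : ℝ} (hθ : 0 < θ) {uA uB Δ : ℝ} (hΔ : |uA - uB| ≤ Δ) :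
    χ (uA / θ) - min (χ (uA / θ)) (χ (uB / θ)) ≤ L * (Δ / θ) * largeInd uA ((1 - κ) * θ - Δ) := by
  have hΔ0 : 0 ≤ Δ := (abs_nonneg _).trans hΔ
  unfold largeInd
  split_ifs with hu
  · rw [mul_one]
    rcases le_total (χ (uA / θ)) (χ (uB / θ)) with hle | hle
    · rw [min_eq_left hle, sub_self]
      exact mul_nonneg h.L_pos.le (div_nonneg hΔ0 hθ.le)
    · rw [min_eq_right hle]
      exact (le_abs_self _).trans (h.abs_profile_sub_profile_le hθ hΔ)
  · have huB : uB ≤ (1 - κ) * θ := by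
      have h1 := (abs_le.1 hΔ).1
      linarith [not_le.1 hu]
    rw [h.eq_one (uB / θ) (by rwa [div_le_iff₀ hθ]), min_eq_left (h.le_one _), sub_self, mul_zero]

/-- … the same bound with the large-field indicator sharpened to the SHELL `1[(1 − κ)θ − Δ ≤ u^A < θ]` of width
`κθ + Δ` (above `θ` the run's own factor vanishes, so there is no mismatch either). [folklore] -/
theorem profile_sub_min_le_shell (h : LipProfile χ κ L) {θ : ℝ} (hθ : 0 < θ) {uA uB Δ : ℝ} (hΔ : |uA - uB| ≤ Δ) :
    χ (uA / θ) - min (χ (uA / θ)) (χ (uB / θ)) ≤ L * (Δ / θ) * shellBelow uA θ (κ * θ + Δ) := by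
  by_cases htop : uA < θ
  · refine (h.profile_sub_min_le hθ hΔ).trans (le_of_eq ?_)
    congr 1
    unfold largeInd shellBelow
    have : θ - (κ * θ + Δ) = (1 - κ) * θ - Δ := by ring
    rw [this]
    by_cases hlow : (1 - κ) * θ - Δ ≤ uA <;> simp [hlow, htop]
  · rw [h.eq_zero (uA / θ) (by rw [le_div_iff₀ hθ, one_mul]; exact not_lt.1 htop),
      min_eq_left (h.nonneg _), sub_self]
    exact mul_nonneg (mul_nonneg h.L_pos.le (div_nonneg ((abs_nonneg _).trans hΔ) hθ.le))
      (shellBelow_nonneg _ _ _)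

/-- The mismatch in RELATIVE form: `Δ = ρθ` gives the level gain `L ρ` and the lowered threshold `(1 − κ − ρ)θ`.
[folklore] -/
theorem profile_sub_min_le_rel (h : LipProfile χ κ L) {θ : ℝ} (hθ : 0 < θ) {uA uB ρ : ℝ}
    (hΔ : |uA - uB| ≤ ρ * θ) :
    χ (uA / θ) - min (χ (uA / θ)) (χ (uB / θ)) ≤ L * ρ * largeInd uA ((1 - κ - ρ) * θ) := by
  have := h.profile_sub_min_le hθ hΔ
  rwa [mul_div_assoc, div_self hθ.ne', mul_one, show (1 - κ) * θ - ρ * θ = (1 - κ - ρ) * θ by ring] at this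

/-- The mismatch is symmetric in the runs: run B's piece is bounded by run B's own large-field indicator. [folklore] -/
theorem profile_sub_min_le_right (h : LipProfile χ κ L) {θ : ℝ} (hθ : 0 < θ) {uA uB Δ : ℝ}
    (hΔ : |uA - uB| ≤ Δ) :
    χ (uB / θ) - min (χ (uA / θ)) (χ (uB / θ)) ≤ L * (Δ / θ) * largeInd uB ((1 - κ) * θ - Δ) := by
  rw [min_comm]
  exact h.profile_sub_min_le hθ (by rwa [abs_sub_comm])

/-- **THE LADDER STEP SURVIVES iff the stronger threshold sits below the weaker profile's plateau.**  If
`0 < θ_s ≤ (1 − κ)θ_w` then wherever the strong factor `χ(u/θ_s)` is nonzero the weak factor `χ(u/θ_w)` EQUALS `1`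
— the smooth form of [Balaban1989LargeFieldI] p. 181 «The restrictions in the function (1.22) imply that the
characteristic functions (1.3) … are equal to 1». [folklore] -/
theorem profile_eq_one_of_ladder (h : LipProfile χ κ L) {θs θw : ℝ} (hθs : 0 < θs) (hθw : 0 < θw)
    (hlad : θs ≤ (1 - κ) * θw) {u : ℝ} (hu : χ (u / θs) ≠ 0) : χ (u / θw) = 1 := by
  have hu1 : u < θs := by
    have := h.lt_one_of_ne_zero hu
    rwa [div_lt_iff₀ hθs, one_mul] at this
  exact h.eq_one _ (by rw [div_le_iff₀ hθw]; linarith)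

/-- … so the weak factor can be DROPPED next to the strong one: `χ(u/θ_s) · χ(u/θ_w) = χ(u/θ_s)`. [folklore] -/
theorem profile_mul_profile_of_ladder (h : LipProfile χ κ L) {θs θw : ℝ} (hθs : 0 < θs) (hθw : 0 < θw)
    (hlad : θs ≤ (1 - κ) * θw) (u : ℝ) : χ (u / θs) * χ (u / θw) = χ (u / θs) := by
  by_cases hu : χ (u / θs) = 0
  · rw [hu, zero_mul]
  · rw [h.profile_eq_one_of_ladder hθs hθw hlad hu, mul_one]

/-- WITHOUT the ladder condition the step FAILS for smooth profiles: if `(1 − κ)θ_w < θ_s` there is a point where the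
strong factor is nonzero but the weak factor is not `1` — witnessed by the piecewise-linear profile (so the condition
`θ_s ≤ (1 − κ)θ_w` of `profile_eq_one_of_ladder` is SHARP for design (η), and `κ` must fit inside the printed ladder
gaps, §4). [folklore] -/
theorem ladder_sharp {κ θs θw : ℝ} (h0 : 0 < κ) (h1 : κ < 1) (hθw : 0 < θw) (hgap : (1 - κ) * θw < θs) :
    ∃ u, linProfile κ (u / θs) ≠ 0 ∧ linProfile κ (u / θw) ≠ 1 := by
  -- take `u` strictly between `(1 − κ)θ_w` and `min θ_s θ_w`
  obtain ⟨u, hu1, hu2⟩ := exists_between (lt_min hgap (by nlinarith : (1 - κ) * θw < θw))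
  have hus : u < θs := hu2.trans_le (min_le_left _ _)
  have huw : u < θw := hu2.trans_le (min_le_right _ _)
  have hθs : 0 < θs := lt_of_le_of_lt (by nlinarith [hθw.le, h1.le]) hgap
  refine ⟨u, ?_, ?_⟩
  · -- `u/θ_s < 1`, so the profile is positive
    have hlt : u / θs < 1 := by rwa [div_lt_iff₀ hθs, one_mul]
    have hpos : 0 < linProfile κ (u / θs) := by
      unfold linProfile
      exact lt_max_of_lt_right (lt_min one_pos (div_pos (by linarith) h0))
    exact hpos.ne'
  · -- `1 − κ < u/θ_w < 1`, so the profile is strictly between 0 and 1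
    have hgt : 1 - κ < u / θw := by rwa [lt_div_iff₀ hθw]
    have hlt1 : (1 - u / θw) / κ < 1 := by rw [div_lt_iff₀ h0]; linarith
    have : linProfile κ (u / θw) ≤ (1 - u / θw) / κ := by
      unfold linProfile
      exact max_le (div_nonneg (by rw [sub_nonneg, div_le_iff₀ hθw]; linarith) h0.le) (min_le_right _ _)
    exact ne_of_lt (this.trans_lt hlt1)

end LipProfile

/-- **CUBE FUNCTIONS WITH A SUPREMUM INSIDE inherit the two-run closeness.**  The printed small-field function of a
cube tests `sup_{p ⊂ □~} |U(∂p) − 1|` ([Balaban1988Convergent] (2.17) p. 257); if every plaquette variable of the two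
runs differs by at most `Δ`, so do the suprema — so `LipProfile.profile_sub_min_le` applies to `χ((sup_p u_p)/θ)`.
[folklore] -/
theorem abs_sup'_sub_sup'_le {P : Type*} {s : Finset P} (hs : s.Nonempty) {uA uB : P → ℝ} {Δ : ℝ}
    (h : ∀ p ∈ s, |uA p - uB p| ≤ Δ) : |s.sup' hs uA - s.sup' hs uB| ≤ Δ := by
  rw [abs_le]
  constructor
  · -- `sup uB ≤ sup uA + Δ`
    have : s.sup' hs uB ≤ s.sup' hs uA + Δ :=
      Finset.sup'_le hs _ fun p hp => by
        have := (abs_le.1 (h p hp)).1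
        linarith [Finset.le_sup' uA hp]
    linarith
  · have : s.sup' hs uA ≤ s.sup' hs uB + Δ :=
      Finset.sup'_le hs _ fun p hp => by
        have := (abs_le.1 (h p hp)).2
        linarith [Finset.le_sup' uB hp]
    linarith

/-- … and the same for an INFIMUM (the `inf` over extensions inside [Balaban1989LargeFieldI] (1.75) p. 193).
[folklore] -/
theorem abs_inf'_sub_inf'_le {P : Type*} {s : Finset P} (hs : s.Nonempty) {uA uB : P → ℝ} {Δ : ℝ}
    (h : ∀ p ∈ s, |uA p - uB p| ≤ Δ) : |s.inf' hs uA - s.inf' hs uB| ≤ Δ := by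
  rw [abs_le]
  constructor
  · have : s.inf' hs uB - Δ ≤ s.inf' hs uA :=
      Finset.le_inf' hs _ fun p hp => by
        have := (abs_le.1 (h p hp)).1
        linarith [Finset.inf'_le uB hp]
    linarith
  · have : s.inf' hs uA - Δ ≤ s.inf' hs uB :=
      Finset.le_inf' hs _ fun p hp => by
        have := (abs_le.1 (h p hp)).2
        linarith [Finset.inf'_le uA hp]
    linarith

/-- **POINTWISE, PER TERM: the min-piece of a profile family is (level gain) × (large-field sibling).**  Slot factors
`pᵢ = χ(u^A_i/θᵢ)`, `qᵢ = χ(u^B_i/θᵢ)`, core `min(pᵢ, qᵢ)`, two-run closeness `|u^A_i − u^B_i| ≤ Δᵢ`, remainder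
`R ≥ 0`: `minPieceᵢ · R ≤ (L Δᵢ/θᵢ) · (1[u^A_i ≥ (1 − κ)θᵢ − Δᵢ] · siblingᵢ · R)` — the right-hand side is a
SINGLE-RUN density (run A's term with slot `i`'s small-field factor replaced by a lowered large-field indicator) times
a level-indexed number.  Integrating it against run A's measure is node U5b's business (monotonicity of the integral).
[folklore] -/
theorem minPiece_profile_mul_le {χ : ℝ → ℝ} {κ L : ℝ} (h : LipProfile χ κ L) {n : ℕ} {uA uB θ Δ : ℕ → ℝ}
    (hθ : ∀ i < n, 0 < θ i) (hΔ : ∀ i < n, |uA i - uB i| ≤ Δ i) {i : ℕ} (hi : i < n) {R : ℝ} (hR : 0 ≤ R) :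
    minPiece (fun i => χ (uA i / θ i)) (fun i => min (χ (uA i / θ i)) (χ (uB i / θ i))) n i * R
      ≤ (L * (Δ i / θ i)) *
        (largeInd (uA i) ((1 - κ) * θ i - Δ i) * sibling (fun i => χ (uA i / θ i)) n i * R) := by
  have hc : ∀ i < n, 0 ≤ min (χ (uA i / θ i)) (χ (uB i / θ i)) := fun i _ => le_min (h.nonneg _) (h.nonneg _)
  have hcp : ∀ i < n, min (χ (uA i / θ i)) (χ (uB i / θ i)) ≤ χ (uA i / θ i) := fun i _ => min_le_left _ _
  refine (minPiece_mul_le hc hcp hi hR).trans ?_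
  have hsib : 0 ≤ sibling (fun i => χ (uA i / θ i)) n i := sibling_nonneg (fun i _ => h.nonneg _) hi
  calc (χ (uA i / θ i) - min (χ (uA i / θ i)) (χ (uB i / θ i))) * sibling (fun i => χ (uA i / θ i)) n i * R
      ≤ (L * (Δ i / θ i) * largeInd (uA i) ((1 - κ) * θ i - Δ i)) * sibling (fun i => χ (uA i / θ i)) n i * R :=
        mul_le_mul_of_nonneg_right (mul_le_mul_of_nonneg_right (h.profile_sub_min_le (hθ i hi) (hΔ i hi)) hsib) hR
    _ = _ := by ring

end Profile

/-! ## §3 The constructor: Lipschitz slot ledgers + sibling suppression + the two-run width ⇒ `ShellWeightBound`,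
with the EXACT total `C₀(n, L·S) · Σ_j ρ_j` -/

section Constructor

variable {ι : Type*} {l₀ : ℝ} {T : ℕ → Finset ι} {A B : ℕ → ℝ → ι → ℝ}

/-- THE LIPSCHITZ SLOT LEDGER OF ONE RUN (hypothesis shape — the integrated form of §2 `minPiece_profile_mul_le`,
cell bookkeeping, NOT PRINTED): slots `σ = ⟨a, i⟩` (age `a ≤ N`, copy `i < n a`); slot `σ` has a min-piece weight
`shXs σ` with `0 ≤ shXs σ ≤` the term weight, vanishing in runs younger than the slot (`K < a`: the level `K − a` does
not exist), and bounded ON THE BAND by `L(a) · ρ(K − a) ×` the slot's SIBLING weight `sibXs σ` (the term with the slot's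
small-field factor replaced by the lowered large-field indicator — INTENDED in the SHELL-RESTRICTED form of §6
`minPiece_profile_mul_le_shell`, i.e. the indicator of the layer `(1 − κ)θ − Δ ≤ u < θ`, which stays inside the
support of the slot's own small-field condition `u < θ`, where the term's remaining factors keep their printed
meaning; v1.2 advisory A1 of the cell cross-read) — `L(a)` the profile's Lipschitz constant at age `a` (age-dependent
through the ladder, §4–§5: `2^{a+O(1)}/β²`), `ρ` the two-run relative width of (F∞) by LEVEL. [folklore] -/
structure LipSlotLedger (l₀ : ℝ) (T : ℕ → Finset ι) (X : ℕ → ℝ → ι → ℝ) (N : ℕ) (n : ℕ → ℕ)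
    (shXs sibXs : (Σ _ : ℕ, ℕ) → ℕ → ℝ → ι → ℝ) (Lχ ρ : ℕ → ℝ) : Prop where
  piece_nonneg : ∀ σ ∈ (range (N + 1)).sigma (fun a => range (n a)), ∀ K t, |t| ≤ l₀ → ∀ τ ∈ T K, 0 ≤ shXs σ K t τ
  piece_le : ∀ σ ∈ (range (N + 1)).sigma (fun a => range (n a)), ∀ K t, |t| ≤ l₀ → ∀ τ ∈ T K, shXs σ K t τ ≤ X K t τ
  piece_offband : ∀ σ ∈ (range (N + 1)).sigma (fun a => range (n a)), ∀ K t, |t| ≤ l₀ → K < σ.1 →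
    ∀ τ ∈ T K, shXs σ K t τ ≤ 0
  sib_nonneg : ∀ σ ∈ (range (N + 1)).sigma (fun a => range (n a)), ∀ K t, |t| ≤ l₀ → ∀ τ ∈ T K, 0 ≤ sibXs σ K t τ
  piece_le_sib : ∀ σ ∈ (range (N + 1)).sigma (fun a => range (n a)), ∀ K t, |t| ≤ l₀ → σ.1 ≤ K →
    ∀ τ ∈ T K, shXs σ K t τ ≤ Lχ σ.1 * ρ (K - σ.1) * sibXs σ K t τ

/-- SIBLING SUPPRESSION (NOT PRINTED as a ratio statement; NE7b species — the same TEMPLATE as `T4ShellCount.Lowered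
ThresholdSuppression`: [Balaban1989LargeFieldI] p. 193 «Thus 1 − χ_{k,Λ} is a large field function» at the lowered
threshold `(1 − κ − ρ)θ`, and the per-created-region factor `exp(−p₀(g_j))` of [Balaban1989LargeFieldII] (1.79)
p. 383, indexed by AGE): the total sibling weight of an age-`a` slot is at most `S(a) ×` the run's total weight, for
every `K`. (hypothesis shape, NOT PRINTED) [folklore] -/
def SiblingSuppression (l₀ : ℝ) (T : ℕ → Finset ι) (X : ℕ → ℝ → ι → ℝ) (N : ℕ) (n : ℕ → ℕ)
    (sibXs : (Σ _ : ℕ, ℕ) → ℕ → ℝ → ι → ℝ) (S : ℕ → ℝ) : Prop :=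
  ∀ σ ∈ (range (N + 1)).sigma (fun a => range (n a)), ∀ K t, |t| ≤ l₀ →
    ∑ τ ∈ T K, sibXs σ K t τ ≤ S σ.1 * ∑ τ ∈ T K, X K t τ

/-- The band-cut level gain of design (η): `w a K = L(a) S(a) ρ(K − a)` on the band `a ≤ K`, `0` off it. [folklore] -/
def lipWeight (Lχ S ρ : ℕ → ℝ) (a K : ℕ) : ℝ := if a ≤ K then Lχ a * S a * ρ (K - a) else 0

/-- The band-cut gain is nonnegative for nonnegative data. [folklore] -/
theorem lipWeight_nonneg {Lχ S ρ : ℕ → ℝ} {N : ℕ} (hL : ∀ a ≤ N, 0 ≤ Lχ a) (hS : ∀ a ≤ N, 0 ≤ S a)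
    (hρ : ∀ j, 0 ≤ ρ j) {a : ℕ} (ha : a ≤ N) (K : ℕ) : 0 ≤ lipWeight Lχ S ρ a K := by
  unfold lipWeight
  split_ifs
  · exact mul_nonneg (mul_nonneg (hL a ha) (hS a ha)) (hρ _)
  · exact le_rfl

/-- One age strip of the band-cut gain is a shifted copy of `ρ`, hence summable for summable `ρ`. [folklore] -/
theorem summable_lipWeight {Lχ S ρ : ℕ → ℝ} (hρ : Summable ρ) (a : ℕ) : Summable (lipWeight Lχ S ρ a) := by
  have := summable_bandTerm (m := Lχ) (s := S) hρ a
  exact this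

/-- **ONE SLOT.**  A Lipschitz slot ledger entry with sibling suppression gives the per-slot `ShellWeightBound` with
weight `lipWeight L S ρ a` — summable for summable `ρ`: THE LEVEL GAIN IS THE TWO-RUN WIDTH ITSELF. [folklore] -/
theorem slot_shellWeightBound {N : ℕ} {n : ℕ → ℕ} {shAs sibAs shBs sibBs : (Σ _ : ℕ, ℕ) → ℕ → ℝ → ι → ℝ}
    {Lχ ρ S : ℕ → ℝ} (hLA : LipSlotLedger l₀ T A N n shAs sibAs Lχ ρ) (hLB : LipSlotLedger l₀ T B N n shBs sibBs Lχ ρ)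
    (hSA : SiblingSuppression l₀ T A N n sibAs S) (hSB : SiblingSuppression l₀ T B N n sibBs S)
    (hL : ∀ a ≤ N, 0 ≤ Lχ a) (hS : ∀ a ≤ N, 0 ≤ S a) (hρ0 : ∀ j, 0 ≤ ρ j) (hρ : Summable ρ)
    {σ : Σ _ : ℕ, ℕ} (hσ : σ ∈ (range (N + 1)).sigma (fun a => range (n a))) :
    ShellWeightBound l₀ T A B (shAs σ) (shBs σ) (lipWeight Lχ S ρ σ.1) := by
  have ha : σ.1 ≤ N := Finset.mem_range_succ_iff.1 (mem_sigma.1 hσ).1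
  -- the generic one-run computation
  have key : ∀ {X : ℕ → ℝ → ι → ℝ} {shXs sibXs : (Σ _ : ℕ, ℕ) → ℕ → ℝ → ι → ℝ},
      LipSlotLedger l₀ T X N n shXs sibXs Lχ ρ → SiblingSuppression l₀ T X N n sibXs S →
      ∀ K t, |t| ≤ l₀ → ∑ τ ∈ T K, shXs σ K t τ ≤ lipWeight Lχ S ρ σ.1 K * ∑ τ ∈ T K, X K t τ := by
    intro X shXs sibXs hL' hS' K t ht
    unfold lipWeight
    split_ifs with hK
    · calc ∑ τ ∈ T K, shXs σ K t τ ≤ ∑ τ ∈ T K, Lχ σ.1 * ρ (K - σ.1) * sibXs σ K t τ :=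
            sum_le_sum fun τ hτ => hL'.piece_le_sib σ hσ K t ht hK τ hτ
        _ = Lχ σ.1 * ρ (K - σ.1) * ∑ τ ∈ T K, sibXs σ K t τ := by rw [mul_sum]
        _ ≤ Lχ σ.1 * ρ (K - σ.1) * (S σ.1 * ∑ τ ∈ T K, X K t τ) :=
            mul_le_mul_of_nonneg_left (hS' σ hσ K t ht) (mul_nonneg (hL _ ha) (hρ0 _))
        _ = Lχ σ.1 * S σ.1 * ρ (K - σ.1) * ∑ τ ∈ T K, X K t τ := by ring
    · rw [zero_mul]
      exact sum_nonpos fun τ hτ => hL'.piece_offband σ hσ K t ht (not_le.1 hK) τ hτ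
  exact
    { nonneg := fun K => lipWeight_nonneg hL hS hρ0 ha K
      summable := summable_lipWeight hρ σ.1
      sh_nonneg_left := hLA.piece_nonneg σ hσ
      sh_le_left := hLA.piece_le σ hσ
      sh_nonneg_right := hLB.piece_nonneg σ hσ
      sh_le_right := hLB.piece_le σ hσ
      left := key hLA hSA
      right := key hLB hSB }

/-- **THE CONSTRUCTOR OF DESIGN (η).**  Lipschitz slot ledgers of the two runs (same counts `n`, Lipschitz constants
`L(a)`, width `ρ`), sibling suppression `S(a)` in both runs, `ρ ≥ 0` SUMMABLE over levels (node U4′/(F∞): the only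
two-run input), and the union bounds for the total mismatch parts ⇒ the literal `T4IndicatorShell.ShellWeightBound`
with the band weight `K ↦ Σ_{a ≤ N} n_a · lipWeight L S ρ a K`.  Compare `T4ShellCount.shellWeightBound_of_ageLedger`:
there the level gain `y` had to be supplied from outside the route; here it IS `ρ`. [folklore] -/
theorem shellWeightBound_of_lipProfile {N : ℕ} {n : ℕ → ℕ}
    {shAs sibAs shBs sibBs : (Σ _ : ℕ, ℕ) → ℕ → ℝ → ι → ℝ} {Lχ ρ S : ℕ → ℝ} {shA shB : ℕ → ℝ → ι → ℝ}
    (hLA : LipSlotLedger l₀ T A N n shAs sibAs Lχ ρ) (hLB : LipSlotLedger l₀ T B N n shBs sibBs Lχ ρ)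
    (hSA : SiblingSuppression l₀ T A N n sibAs S) (hSB : SiblingSuppression l₀ T B N n sibBs S)
    (hL : ∀ a ≤ N, 0 ≤ Lχ a) (hS : ∀ a ≤ N, 0 ≤ S a) (hρ0 : ∀ j, 0 ≤ ρ j) (hρ : Summable ρ)
    (hA0 : ∀ K t, |t| ≤ l₀ → ∀ τ ∈ T K, 0 ≤ shA K t τ) (hAle : ∀ K t, |t| ≤ l₀ → ∀ τ ∈ T K, shA K t τ ≤ A K t τ)
    (hAu : ∀ K t, |t| ≤ l₀ → ∀ τ ∈ T K,
      shA K t τ ≤ ∑ σ ∈ (range (N + 1)).sigma (fun a => range (n a)), shAs σ K t τ)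
    (hB0 : ∀ K t, |t| ≤ l₀ → ∀ τ ∈ T K, 0 ≤ shB K t τ) (hBle : ∀ K t, |t| ≤ l₀ → ∀ τ ∈ T K, shB K t τ ≤ B K t τ)
    (hBu : ∀ K t, |t| ≤ l₀ → ∀ τ ∈ T K,
      shB K t τ ≤ ∑ σ ∈ (range (N + 1)).sigma (fun a => range (n a)), shBs σ K t τ) :
    ShellWeightBound l₀ T A B shA shB (fun K => ∑ a ∈ range (N + 1), (n a : ℝ) * lipWeight Lχ S ρ a K) :=
  shellWeightBound_of_levels (range (N + 1)) n (w := lipWeight Lχ S ρ)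
    (fun _ hσ => slot_shellWeightBound hLA hLB hSA hSB hL hS hρ0 hρ hσ) hA0 hAle hAu hB0 hBle hBu

/-- Its weight IS `T4ShellCount.bandMajorant N n (L·S) ρ`. [folklore] -/
theorem weight_eq_bandMajorant {N : ℕ} (n : ℕ → ℕ) (Lχ S ρ : ℕ → ℝ) (K : ℕ) :
    (∑ a ∈ range (N + 1), (n a : ℝ) * lipWeight Lχ S ρ a K)
      = bandMajorant N (fun a => (n a : ℝ)) (fun a => Lχ a * S a) ρ K := by
  unfold lipWeight bandMajorant
  refine sum_congr rfl fun a _ => ?_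
  split_ifs <;> ring

/-- **THE EXACT TWO-RUN COST OF DESIGN (η):** `Σ_K Wsh_K = C₀(n, L·S) · Σ_j ρ_j` — (cube count × Lipschitz constant ×
sibling suppression, summed over the live window ONCE) × (the total two-run width over levels).
(`T4ShellCount.tsum_bandMajorant`) [folklore] -/
theorem tsum_weight_eq {N : ℕ} (n : ℕ → ℕ) (Lχ S : ℕ → ℝ) {ρ : ℕ → ℝ} (hρ : Summable ρ) :
    ∑' K, (∑ a ∈ range (N + 1), (n a : ℝ) * lipWeight Lχ S ρ a K)
      = C0 N (fun a => (n a : ℝ)) (fun a => Lχ a * S a) * ∑' j, ρ j := by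
  simp_rw [weight_eq_bandMajorant]
  exact tsum_bandMajorant hρ

/-- The ratios of design (η) ARE a `T4ShellCount.LevelGain` with `y = ρ` whenever `L(a) S(a) ≤ e^{−p(a)}` (the
Lipschitz constant absorbed into the suppression exponent): the typed missing inequality of the route is MET, by the
two-run width alone. [folklore] -/
theorem levelGain_of_lipWeight {N : ℕ} {Lχ S ρ p : ℕ → ℝ} (hL : ∀ a ≤ N, 0 ≤ Lχ a) (hS : ∀ a ≤ N, 0 ≤ S a)
    (hρ0 : ∀ j, 0 ≤ ρ j) (hρ : Summable ρ) (hp : ∀ a ≤ N, Lχ a * S a ≤ Real.exp (-p a)) :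
    LevelGain N (lipWeight Lχ S ρ) p ρ := by
  refine ⟨fun a ha K => ⟨lipWeight_nonneg hL hS hρ0 ha K, ?_⟩, hρ0, hρ⟩
  unfold lipWeight
  split_ifs
  · exact mul_le_mul_of_nonneg_right (hp a ha) (hρ0 _)
  · exact mul_nonneg (Real.exp_pos _).le (hρ0 _)

/-- Cube count ⇒ the constant is at most `V · Σ_{a ≤ N} Λ^a L(a) S(a)`. [folklore] -/
theorem C0_le_of_cubeCount' {N : ℕ} {n : ℕ → ℕ} {V Λ : ℝ} {s : ℕ → ℝ} (hc : CubeCount N n V Λ)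
    (hs : ∀ a ≤ N, 0 ≤ s a) :
    C0 N (fun a => (n a : ℝ)) s ≤ V * ∑ a ∈ range (N + 1), Λ ^ a * s a := by
  unfold C0
  rw [mul_sum]
  refine sum_le_sum fun a ha => ?_
  rw [← mul_assoc]
  exact mul_le_mul_of_nonneg_right (hc a (Finset.mem_range_succ_iff.1 ha)) (hs a (Finset.mem_range_succ_iff.1 ha))

/-- **PRINTED SHAPES + DESIGN (η) ⇒ THE TOTAL.**  Cube count, sibling suppression `S(a) ≤ e^{−p(a)}`, Lipschitz
constants `L(a) ≥ 0`, summable width: `Σ_K Wsh_K ≤ V · (Σ_{a ≤ N} Λ^a L(a) e^{−p(a)}) · Σ_j ρ_j`.  The positivity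
margin this asks of the programme's numbers is the route's old one with `log L(a) ≤ (M(a) + 1) log 2 + log β⁻¹` (§4)
added to the window entropy `a log Λ` against the exponent `p(a)` — AGE-only, paid once. [folklore] -/
theorem tsum_weight_le_of_printedShapes {N : ℕ} {n : ℕ → ℕ} {V Λ : ℝ} {Lχ S ρ p : ℕ → ℝ}
    (hc : CubeCount N n V Λ) (hL : ∀ a ≤ N, 0 ≤ Lχ a) (hS : ∀ a ≤ N, 0 ≤ S a ∧ S a ≤ Real.exp (-p a))
    (hρ0 : ∀ j, 0 ≤ ρ j) (hρ : Summable ρ) (hΛ : 0 ≤ Λ) :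
    ∑' K, (∑ a ∈ range (N + 1), (n a : ℝ) * lipWeight Lχ S ρ a K)
      ≤ (V * ∑ a ∈ range (N + 1), Λ ^ a * (Lχ a * Real.exp (-p a))) * ∑' j, ρ j := by
  rw [tsum_weight_eq n Lχ S hρ]
  refine mul_le_mul_of_nonneg_right ?_ (tsum_nonneg hρ0)
  refine (C0_le_of_cubeCount' hc fun a ha => mul_nonneg (hL a ha) (hS a ha).1).trans ?_
  have hV : 0 ≤ V := by
    have := hc 0 (Nat.zero_le _)
    rw [pow_zero, mul_one] at this
    exact (Nat.cast_nonneg _).trans this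
  refine mul_le_mul_of_nonneg_left (sum_le_sum fun a ha => ?_) hV
  have ha' := Finset.mem_range_succ_iff.1 ha
  exact mul_le_mul_of_nonneg_left (mul_le_mul_of_nonneg_left (hS a ha').2 (hL a ha')) (pow_nonneg hΛ _)

/-- CONTRAST WITH THE WALL.  Under design (η) the final-scale slot's ratio is `L(0) S(0) ρ_K → 0` (summable `ρ`), so
the saturation hypothesis of `T4ShellCount.not_summable_of_printedShapes_saturated` — the age-`0` ratio staying above a
fixed fraction of `e^{−p 0}` along infinitely many `K` — is exactly what (η) removes. [folklore] -/
theorem lipWeight_zero_tendsto {Lχ S ρ : ℕ → ℝ} (hρ : Summable ρ) :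
    Tendsto (fun K => lipWeight Lχ S ρ 0 K) atTop (𝓝 0) := by
  have h := (hρ.mul_left (Lχ 0 * S 0)).tendsto_atTop_zero
  refine h.congr fun K => ?_
  simp [lipWeight]

end Constructor

/-! ## §4 The printed ladder: which transition widths `κ` are admissible -/

section Ladder

/-- The printed threshold RUNGS `r_m = 1 − β(1 − 2^{−m})` of [Balaban1989LargeFieldI] (1.22)–(1.24) pp. 181–182
(`r_0 = 1` the bare threshold of (1.3), `r_1 = 1 − β½` of (1.22), `r_2 = 1 − β(½ + 1/2²)` of (1.23), …; `0 < β ≤ 1/2`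
p. 182), as multiples of the base threshold `ε_h(L^{k−h}η)²`. (PRINTED SHAPE) [folklore] -/
def rung (β : ℝ) (m : ℕ) : ℝ := 1 - β * (1 - (2 : ℝ)⁻¹ ^ m)

/-- The bare threshold is rung `0`. [folklore] -/
theorem rung_zero (β : ℝ) : rung β 0 = 1 := by simp [rung]

/-- Rung `1` is the factor `1 − β½` of (1.22). [folklore] -/
theorem rung_one (β : ℝ) : rung β 1 = 1 - β * 2⁻¹ := by rw [rung, pow_one]; ring

/-- Consecutive rungs differ by `β2^{−(m+1)}` — the printed LADDER GAP, shrinking geometrically with the rung index `m`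
(`m + 1 = j − i + 1` for the region `Z″_{i+1}∖Z″_i` at integration index `j`, (1.49) p. 186: the number of integrations
since the region's level; v1.2 DOCFIX F2: the p. 181 sentence «the power being proportional to a number of overlapping
regions» quoted here by v1/v1.1 describes the `L₀^{2max{0,i−k₀−1}}` factors, not this gap). [folklore] -/
theorem rung_sub_rung_succ (β : ℝ) (m : ℕ) : rung β m - rung β (m + 1) = β * 2⁻¹ ^ (m + 1) := by
  simp only [rung, pow_succ]; ring

/-- Rungs do not exceed the bare threshold. [folklore] -/
theorem rung_le_one {β : ℝ} (hβ : 0 ≤ β) (m : ℕ) : rung β m ≤ 1 := by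
  unfold rung
  have : 0 ≤ 1 - (2 : ℝ)⁻¹ ^ m := sub_nonneg.2 (pow_le_one₀ (by norm_num) (by norm_num))
  nlinarith

/-- Rungs are positive for `0 ≤ β < 1` (print: `0 < β ≤ 1/2`). [folklore] -/
theorem rung_pos {β : ℝ} (hβ1 : β < 1) (hβ : 0 ≤ β) (m : ℕ) : 0 < rung β m := by
  unfold rung
  have h1 : 1 - (2 : ℝ)⁻¹ ^ m ≤ 1 := sub_le_self _ (pow_nonneg (by norm_num) _)
  have h0 : 0 ≤ 1 - (2 : ℝ)⁻¹ ^ m := sub_nonneg.2 (pow_le_one₀ (by norm_num) (by norm_num))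
  nlinarith [mul_le_mul_of_nonneg_left h1 hβ]

/-- **BARE-GAP ADMISSIBILITY** (thresholds compared directly; the printed chains' residual version is §5).  If
`0 ≤ κ ≤ β2^{−(m+1)}` (and `0 ≤ β ≤ 1`) then the next rung sits below the plateau of the
current one: `r_{m+1} ≤ (1 − κ) r_m` — the hypothesis of `LipProfile.profile_eq_one_of_ladder` for the printed step
from rung `m` to rung `m + 1`. [folklore] -/
theorem rung_succ_le_of_kappa_le {β κ : ℝ} (hβ : 0 ≤ β) (hβ1 : β ≤ 1) (hκ : 0 ≤ κ) {m : ℕ}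
    (hκm : κ ≤ β * 2⁻¹ ^ (m + 1)) : rung β (m + 1) ≤ (1 - κ) * rung β m := by
  have hgap := rung_sub_rung_succ β m
  have hr1 : rung β m ≤ 1 := rung_le_one hβ m
  have hr0 : 0 ≤ rung β m := by
    unfold rung
    have : (1 - (2 : ℝ)⁻¹ ^ m) ≤ 1 := sub_le_self _ (pow_nonneg (by norm_num) _)
    nlinarith
  -- `κ · r_m ≤ κ ≤ β2^{−(m+1)} = r_m − r_{m+1}`
  nlinarith [mul_le_mul_of_nonneg_left hr1 hκ]

/-- **UNIFORM ADMISSIBILITY over the live window.**  `κ ≤ β2^{−(M+1)}` makes EVERY printed ladder step `m → m + 1` with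
`m ≤ M` survive the smoothing (`M + 1` = the largest rung exponent at the slot = `j − h + 1 ≤ N + 1`, first line of
(1.24) p. 181 and (1.49) p. 186 with `h = k − N`: so `M ≤ N`, the live window — v1.2 DOCFIX F1/F2); the price is the
Lipschitz constant `L ≥ κ⁻¹ ≥ 2^{M+1}/β` (§2), an AGE-only number. [folklore] -/
theorem ladder_admissible {β κ : ℝ} (hβ : 0 ≤ β) (hβ1 : β ≤ 1) (hκ : 0 ≤ κ) {M : ℕ} (hκM : κ ≤ β * 2⁻¹ ^ (M + 1))
    {m : ℕ} (hm : m ≤ M) : rung β (m + 1) ≤ (1 - κ) * rung β m := by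
  refine rung_succ_le_of_kappa_le hβ hβ1 hκ (hκM.trans (mul_le_mul_of_nonneg_left ?_ hβ))
  exact pow_le_pow_of_le_one (by norm_num) (by norm_num) (by omega)

/-- … and then, for a tested variable `u` and base threshold `θ₀ > 0`, the profile at rung `m + 1` makes the profile at
rung `m` IDENTICALLY `1` next to it — the smooth form of every printed "are equal to 1" step on the ladder. [folklore] -/
theorem profile_ladder_step {χ : ℝ → ℝ} {κ L : ℝ} (h : LipProfile χ κ L) {β : ℝ} (hβ : 0 ≤ β) (hβ1 : β < 1)
    {M m : ℕ} (hκM : κ ≤ β * 2⁻¹ ^ (M + 1)) (hm : m ≤ M) {θ₀ : ℝ} (hθ₀ : 0 < θ₀) (u : ℝ) :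
    χ (u / (rung β (m + 1) * θ₀)) * χ (u / (rung β m * θ₀)) = χ (u / (rung β (m + 1) * θ₀)) := by
  refine h.profile_mul_profile_of_ladder (mul_pos (rung_pos hβ1 hβ _) hθ₀) (mul_pos (rung_pos hβ1 hβ _) hθ₀) ?_ u
  rw [← mul_assoc]
  exact mul_le_mul_of_nonneg_right (ladder_admissible hβ hβ1.le h.kappa_pos.le hκM hm) hθ₀.le

/-- THE PRICE IN THE CONSTANT: an admissible profile has `L ≥ 2^{M+1}/β` (from `L ≥ κ⁻¹`, §2). [folklore] -/
theorem L_ge_of_admissible {χ : ℝ → ℝ} {κ L β : ℝ} (h : LipProfile χ κ L) (hβ : 0 < β) {M : ℕ}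
    (hκM : κ ≤ β * 2⁻¹ ^ (M + 1)) : 2 ^ (M + 1) / β ≤ L := by
  refine le_trans ?_ h.inv_kappa_le
  have hpos : 0 < β * 2⁻¹ ^ (M + 1) := mul_pos hβ (pow_pos (by norm_num) _)
  have heq : (2 : ℝ) ^ (M + 1) / β = (β * 2⁻¹ ^ (M + 1))⁻¹ := by
    rw [mul_inv, inv_pow, inv_inv, div_eq_mul_inv, mul_comm]
  rw [heq]
  exact inv_anti₀ h.kappa_pos hκM

end Ladder

/-! ## §5 (v1.1) The RESIDUAL slack of the printed «equal to 1» chains — what actually bounds `κ`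

§4 is the arithmetic of the BARE ladder gaps.  Reading [Balaban1989LargeFieldI] pp. 183–187 as images shows that the
printed «equal to 1» steps are NOT bare threshold comparisons: p. 183 «Now we will prove that the restrictions
introduced by the new characteristic functions imply that the functions (1.3), (1.4), (1.5), (1.7), (1.8), χ_k^{(n)} are
equal to 1. More precisely, we have» the identity (1.29), and each step is a regularity CHAIN consuming part of the
gap.  Under design (η) a step survives iff the chain's IMPLIED bound for the old tested variable lies inside the old
profile's plateau `{χ = 1} = (−∞, (1 − κ)θ_old]`, i.e. iff `κ` does not exceed the chain's RESIDUAL slack (relative to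
`θ_old`).  Two printed chains, verbatim, as kernel arithmetic:
(1.31) p. 184 (for the functions (1.3)): `|U_{j,□}(∂p) − 1| < (1 + (2β/10)ε_jξ)(1 − β½)ε_jξ² + (2β/10)ε_jξ²(1 +
(4β/10)ε_j) < (1 − β/2 + (2β/10)L^{−2} + 4β/10)ε_jξ² < ε_j(L^{k−j}η)² for p ⊂ □~.` «Thus the functions (1.3) in the
product on the left-hand side of (1.29) are equal to 1.» — residual factor `slack131 β L = 1 − β/10 + (β/5)L^{−2}`,
so `κ ≤ β/10 − (β/5)L^{−2}` is admissible for this step (`step131_admissible`); print's own closing `slack131 < 1`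
is `L² > 2` (`slack131_lt_one`).
(1.48) p. 186 (for `χ_k^{(n)}`, the rung step): `|U^{(n)}_{k,Z}(∂p) − 1| ≤ |U^{(n+1)}_{k,Z}(∂p) − 1|(1 + αβ2^{−(j−i)})
+ αβ2^{−(j−i)}ε_i(L^{k−i}η)²` «where y is as in (1.46)», the constant introduced just before as «Let us choose a bound
for these two factors in the form αβ, where an absolute constant α will be chosen later» (the two factors «can be
made arbitrarily small by choosing γ, or A₁/A₀ sufficiently small» p. 186); the new restriction is the rung with
exponent `j − i + 2` and the old one (1.49) the rung with exponent `j − i + 1`; (1.50) p. 187: `… < (1 − β(1 −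
2^{−(j−i+1)}) − β2^{−(j−i+2)} + 2αβ2^{−(j−i)})L₀^{2max{0,i−k₀−1}}ε_i(L^{k−i}η)²,` «and the last inequality implies
(1.49) if 8α ≤ 1.» … «Thus taking α = 1/8 in (1.48) we satisfy all the conditions.»  With `d = j − i`, `g = β2^{−(d+2)}`
(the bare gap) and `e = αβ2^{−d} = 4αg`: the DISPLAYED inequality (1.50) bounds the cross term `r_{d+2}·e` by `e` and
leaves the residual `g(1 − 8α)` — ZERO at the printed `α = 1/8` (`rung_step_displayed`, `displayed_residual_zero`);
the chain (1.48) itself leaves `g − e(1 + r_{d+2}) = g(1 − 4α(1 + r_{d+2}))` (`rung_step_exact_residual`), which at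
`α = 1/8` equals `½g·β(1 − 2^{−(d+2)}) ≥ (3/8)β·g > 0` (`printed_alpha_residual`).  CONSEQUENCE for the price of (η):
WITHOUT re-choosing any printed constant, `κ ≤ (3/8)β·β2^{−(M+1)}` is admissible for every rung step with old exponent
`≤ M` (`rung_step_admissible_printed`), and re-choosing `α < 1/8` (print's own latitude, p. 186) improves this to
`κ ≤ (1 − 8α)β2^{−(M+1)}` (`rung_step_admissible`); together with (1.31): `κ ≤ min(β/10 − (β/5)L^{−2}, …)`.  The
species of the price (§2–§4: an AGE-only Lipschitz constant `L_χ ≥ κ^{−1}` inside `C₀`) is unchanged; its bookkeeping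
against printed numbers is: `κ` below the minimum RESIDUAL slack of the chains the run actually uses.  The analogous
locus in [Balaban1989LargeFieldII] p. 378 — «The number M₀ in the definition (1.101) [IV] is not fixed yet; we choose it
as equal to the above bound, i.e., M₀ = O(1)B₅M⁶. This implies that the characteristic function χ is also equal to
1.» — fixes a free constant AT the implied bound (zero displayed residual); under (η) `M₀` is chosen larger by the factor
`(1 − κ)^{−1}`, inside print's `O(1)`.  Chains NOT read by this seat are not classified here (the record's census lists
the located pages).  [folklore arithmetic about verbatim printed inequalities; no claim that the modified procedure
has been carried out] -/

section Residual

/-- The residual factor of the chain (1.31) p. 184: `1 − β/2 + (2β/10)L^{−2} + 4β/10`, verbatim. (PRINTED SHAPE)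
[folklore] -/
def slack131 (β L : ℝ) : ℝ := 1 - β / 2 + 2 * β / 10 * (L ^ 2)⁻¹ + 4 * β / 10

/-- … `= 1 − β/10 + (β/5)L^{−2}`. [folklore] -/
theorem slack131_eq (β L : ℝ) : slack131 β L = 1 - β / 10 + β / 5 * (L ^ 2)⁻¹ := by
  unfold slack131; ring

/-- Print's closing inequality `slack131 β L < 1` (the last `<` of (1.31)) holds exactly when `L² > 2`; in particular
for the block size `L ≥ 2`. [folklore] -/
theorem slack131_lt_one {β L : ℝ} (hβ : 0 < β) (hL : 2 ≤ L) : slack131 β L < 1 := by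
  rw [slack131_eq]
  have hL2 : (L ^ 2)⁻¹ ≤ 4⁻¹ := by
    apply inv_anti₀ (by norm_num)
    nlinarith
  nlinarith

/-- **(1.31) under (η).**  `κ ≤ β/10 − (β/5)L^{−2}` puts the chain's implied bound inside the old profile's plateau:
`slack131 β L ≤ 1 − κ`. [folklore] -/
theorem step131_admissible {β L κ : ℝ} (hκ : κ ≤ β / 10 - β / 5 * (L ^ 2)⁻¹) : slack131 β L ≤ 1 - κ := by
  rw [slack131_eq]; linarith

/-- … hence the old function (1.3), as a profile at threshold `θ`, is IDENTICALLY `1` wherever the chain gives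
`u ≤ slack131 β L · θ` (which it does on the support of the new function, by the upper sandwich §2). [folklore] -/
theorem LipProfile.profile_eq_one_of_step131 {χ : ℝ → ℝ} {κ Lχ : ℝ} (h : LipProfile χ κ Lχ) {β L θ u : ℝ}
    (hθ : 0 < θ) (hu : u ≤ slack131 β L * θ) (hκ : κ ≤ β / 10 - β / 5 * (L ^ 2)⁻¹) : χ (u / θ) = 1 := by
  refine h.eq_one _ ?_
  rw [div_le_iff₀ hθ]
  exact hu.trans (mul_le_mul_of_nonneg_right (step131_admissible hκ) hθ.le)

/-- `2^{−d} = 4·2^{−(d+2)}`: the error scale of (1.48) against the bare gap of the rung step. [folklore] -/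
theorem half_pow_eq_four_mul (d : ℕ) : (2 : ℝ)⁻¹ ^ d = 4 * 2⁻¹ ^ (d + 2) := by
  rw [pow_succ, pow_succ]; ring

/-- **The DISPLAYED chain (1.50) p. 187.**  If the new restriction gives `x ≤ r_{d+2}` (`x` = the new tested variable
over the base threshold, `d = j − i`), then the implied bound (1.48) for the old variable satisfies
`x(1 + αβ2^{−d}) + αβ2^{−d} ≤ r_{d+1} − (1 − 8α)·β2^{−(d+2)}` — print's «implies (1.49) if 8α ≤ 1» with the residual
made explicit (print bounds the cross term `r_{d+2}·αβ2^{−d}` by `αβ2^{−d}`). [folklore] -/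
theorem rung_step_displayed {α β x : ℝ} (hα : 0 ≤ α) (hβ : 0 ≤ β) (d : ℕ) (hx : x ≤ rung β (d + 2)) :
    x * (1 + α * β * 2⁻¹ ^ d) + α * β * 2⁻¹ ^ d
      ≤ rung β (d + 1) - (1 - 8 * α) * (β * 2⁻¹ ^ (d + 2)) := by
  have he : 0 ≤ α * β * 2⁻¹ ^ d := by positivity
  have hr1 : rung β (d + 2) ≤ 1 := rung_le_one hβ _
  have hgap : rung β (d + 1) - rung β (d + 1 + 1) = β * 2⁻¹ ^ (d + 1 + 1) := rung_sub_rung_succ β (d + 1)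
  have h4 : α * β * 2⁻¹ ^ d = 4 * α * (β * 2⁻¹ ^ (d + 2)) := by rw [half_pow_eq_four_mul]; ring
  have hx' : x * (1 + α * β * 2⁻¹ ^ d) ≤ rung β (d + 2) * (1 + α * β * 2⁻¹ ^ d) :=
    mul_le_mul_of_nonneg_right hx (by linarith)
  have hcross : rung β (d + 2) * (α * β * 2⁻¹ ^ d) ≤ 1 * (α * β * 2⁻¹ ^ d) :=
    mul_le_mul_of_nonneg_right hr1 he
  have : (d + 1 + 1) = d + 2 := rfl
  nlinarith

/-- At the printed choice `α = 1/8` the displayed residual is ZERO: (1.50) closes with no margin. [folklore] -/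
theorem displayed_residual_zero (β : ℝ) (d : ℕ) : (1 - 8 * (8 : ℝ)⁻¹) * (β * 2⁻¹ ^ (d + 2)) = 0 := by norm_num

/-- **The EXACT residual of the chain (1.48)** when the new restriction is saturated (`x = r_{d+2}`):
`r_{d+1} − (r_{d+2}(1 + e) + e) = g·(1 − 4α(1 + r_{d+2}))` with `g = β2^{−(d+2)}`, `e = αβ2^{−d}`. [folklore] -/
theorem rung_step_exact_residual (α β : ℝ) (d : ℕ) :
    rung β (d + 1) - (rung β (d + 2) * (1 + α * β * 2⁻¹ ^ d) + α * β * 2⁻¹ ^ d)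
      = β * 2⁻¹ ^ (d + 2) * (1 - 4 * α * (1 + rung β (d + 2))) := by
  have hgap : rung β (d + 1) - rung β (d + 1 + 1) = β * 2⁻¹ ^ (d + 1 + 1) := rung_sub_rung_succ β (d + 1)
  have h4 : (2 : ℝ)⁻¹ ^ d = 4 * 2⁻¹ ^ (d + 2) := half_pow_eq_four_mul d
  have : (d + 1 + 1) = d + 2 := rfl
  rw [this] at hgap
  rw [h4]; linear_combination hgap

/-- … which at the printed `α = 1/8` equals `½·g·β(1 − 2^{−(d+2)})` — positive for `β > 0`: the chain (1.48) itself
(not its displayed rounding (1.50)) leaves room for a transition layer WITHOUT re-choosing `α`. [folklore] -/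
theorem printed_alpha_residual (β : ℝ) (d : ℕ) :
    β * 2⁻¹ ^ (d + 2) * (1 - 4 * (8 : ℝ)⁻¹ * (1 + rung β (d + 2)))
      = 2⁻¹ * (β * 2⁻¹ ^ (d + 2)) * (β * (1 - 2⁻¹ ^ (d + 2))) := by
  unfold rung; ring

/-- … and `½·β(1 − 2^{−(d+2)}) ≥ (3/8)β`: the printed-α residual is at least the fraction `(3/8)β` of the bare gap.
[folklore] -/
theorem printed_alpha_residual_ge {β : ℝ} (hβ : 0 ≤ β) (d : ℕ) :
    3 / 8 * β * (β * 2⁻¹ ^ (d + 2)) ≤ 2⁻¹ * (β * 2⁻¹ ^ (d + 2)) * (β * (1 - 2⁻¹ ^ (d + 2))) := by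
  have hp : (2 : ℝ)⁻¹ ^ (d + 2) ≤ 4⁻¹ := by
    rw [pow_succ, pow_succ]
    have : (2 : ℝ)⁻¹ ^ d ≤ 1 := pow_le_one₀ (by norm_num) (by norm_num)
    nlinarith
  have hg : 0 ≤ β * 2⁻¹ ^ (d + 2) := by positivity
  nlinarith [mul_nonneg hg hβ]

/-- **RUNG STEP under (η), printed constants untouched.**  With `0 ≤ κ ≤ (3/8)β·β2^{−(d+2)}` (and `0 ≤ β`) the
implied bound of the chain (1.48) at `α = 1/8` lies inside the old profile's plateau `(1 − κ)·r_{d+1}`. [folklore] -/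
theorem rung_step_admissible_printed {β κ x : ℝ} (hβ : 0 ≤ β) (hκ : 0 ≤ κ) (d : ℕ)
    (hx : x ≤ rung β (d + 2)) (hκd : κ ≤ 3 / 8 * β * (β * 2⁻¹ ^ (d + 2))) :
    x * (1 + 8⁻¹ * β * 2⁻¹ ^ d) + 8⁻¹ * β * 2⁻¹ ^ d ≤ (1 - κ) * rung β (d + 1) := by
  have hres := rung_step_exact_residual 8⁻¹ β d
  have hpr := printed_alpha_residual β d
  have hge := printed_alpha_residual_ge hβ d
  have hr1 : rung β (d + 1) ≤ 1 := rung_le_one hβ _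
  have he : 0 ≤ (8 : ℝ)⁻¹ * β * 2⁻¹ ^ d := by positivity
  have hx' : x * (1 + 8⁻¹ * β * 2⁻¹ ^ d) ≤ rung β (d + 2) * (1 + 8⁻¹ * β * 2⁻¹ ^ d) :=
    mul_le_mul_of_nonneg_right hx (by linarith)
  nlinarith [mul_le_mul_of_nonneg_left hr1 hκ]

/-- **RUNG STEP under (η), `α` re-chosen.**  With `0 ≤ α`, `0 ≤ κ ≤ (1 − 8α)·β2^{−(d+2)}` the displayed chain already
suffices: implied bound `≤ (1 − κ)·r_{d+1}`.  (`α < 1/8` is within print's latitude p. 186; e.g. `α = 1/16` gives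
`κ ≤ ½β2^{−(d+2)}`.) [folklore] -/
theorem rung_step_admissible {α β κ x : ℝ} (hα : 0 ≤ α) (hβ : 0 ≤ β) (hκ : 0 ≤ κ) (d : ℕ)
    (hx : x ≤ rung β (d + 2)) (hκd : κ ≤ (1 - 8 * α) * (β * 2⁻¹ ^ (d + 2))) :
    x * (1 + α * β * 2⁻¹ ^ d) + α * β * 2⁻¹ ^ d ≤ (1 - κ) * rung β (d + 1) := by
  have h := rung_step_displayed hα hβ d hx
  have hr1 : rung β (d + 1) ≤ 1 := rung_le_one hβ _
  nlinarith [mul_le_mul_of_nonneg_left hr1 hκ]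

/-- UNIFORM form over the live window: `κ ≤ (1 − 8α)β2^{−(M+2)}` serves every rung step with `d ≤ M`
(`d = j − i`; old exponent `d + 1 ≤ M + 1`). [folklore] -/
theorem rung_steps_admissible {α β κ : ℝ} (hα : 0 ≤ α) (hα8 : 8 * α ≤ 1) (hβ : 0 ≤ β) (hκ : 0 ≤ κ) {M : ℕ}
    (hκM : κ ≤ (1 - 8 * α) * (β * 2⁻¹ ^ (M + 2))) {d : ℕ} (hd : d ≤ M) {x : ℝ} (hx : x ≤ rung β (d + 2)) :
    x * (1 + α * β * 2⁻¹ ^ d) + α * β * 2⁻¹ ^ d ≤ (1 - κ) * rung β (d + 1) := by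
  refine rung_step_admissible hα hβ hκ d hx (hκM.trans ?_)
  have hpow : (2 : ℝ)⁻¹ ^ (M + 2) ≤ 2⁻¹ ^ (d + 2) :=
    pow_le_pow_of_le_one (by norm_num) (by norm_num) (by omega)
  have h8 : 0 ≤ 1 - 8 * α := by linarith
  exact mul_le_mul_of_nonneg_left (mul_le_mul_of_nonneg_left hpow hβ) h8

/-- … and then the old profile is identically `1` next to the new one: for base threshold `θ₀ > 0`, tested variables
`u_new, u_old ≥ 0` with `u_new ≤ r_{d+2}θ₀` on the support of the new function and the printed chain
`u_old ≤ u_new(1 + αβ2^{−d}) + αβ2^{−d}θ₀` (1.48), the old profile `χ(u_old/(r_{d+1}θ₀)) = 1`. [folklore] -/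
theorem LipProfile.profile_eq_one_of_rung_chain {χ : ℝ → ℝ} {κ Lχ : ℝ} (h : LipProfile χ κ Lχ) {α β : ℝ}
    (hα : 0 ≤ α) (hβ : 0 ≤ β) (hβ1 : β < 1) (d : ℕ) (hκd : κ ≤ (1 - 8 * α) * (β * 2⁻¹ ^ (d + 2)))
    {θ₀ unew uold : ℝ} (hθ₀ : 0 < θ₀) (hnew : unew ≤ rung β (d + 2) * θ₀)
    (hchain : uold ≤ unew * (1 + α * β * 2⁻¹ ^ d) + α * β * 2⁻¹ ^ d * θ₀) :
    χ (uold / (rung β (d + 1) * θ₀)) = 1 := by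
  have hr : 0 < rung β (d + 1) := rung_pos hβ1 hβ _
  refine h.eq_one _ ?_
  rw [div_le_iff₀ (mul_pos hr hθ₀), ← mul_assoc]
  have hstep := rung_step_admissible hα hβ h.kappa_pos.le d (x := unew / θ₀)
    (by rwa [div_le_iff₀ hθ₀]) hκd
  have hmul := mul_le_mul_of_nonneg_right hstep hθ₀.le
  have hdiv : unew / θ₀ * θ₀ = unew := div_mul_cancel₀ _ hθ₀.ne'
  have expand : (unew / θ₀ * (1 + α * β * 2⁻¹ ^ d) + α * β * 2⁻¹ ^ d) * θ₀
      = unew * (1 + α * β * 2⁻¹ ^ d) + α * β * 2⁻¹ ^ d * θ₀ := by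
    calc (unew / θ₀ * (1 + α * β * 2⁻¹ ^ d) + α * β * 2⁻¹ ^ d) * θ₀
        = unew / θ₀ * θ₀ * (1 + α * β * 2⁻¹ ^ d) + α * β * 2⁻¹ ^ d * θ₀ := by ring
      _ = unew * (1 + α * β * 2⁻¹ ^ d) + α * β * 2⁻¹ ^ d * θ₀ := by rw [hdiv]
  rw [expand] at hmul
  exact hchain.trans hmul

end Residual

/-! ## §6 (v1.2) The cell cross-read's advisories A1–A3 as lemmas: the SHELL-RESTRICTED per-term bound, the
LARGE-FIELD-slot pair, the chain (1.52)

A1.  §2 `minPiece_profile_mul_le` dominates the slot-`i` min-piece by the sibling carrying the UNRESTRICTED lowered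
indicator `1[u^A_i ≥ (1 − κ)θ_i − Δ_i]`; that sibling also lives where `u^A_i ≥ θ_i`, i.e. OUTSIDE the support of the
term's own slot-`i` small-field condition, where the term's remaining factors (background functionals, the small-field
representation of the step) carry no printed meaning.  The layer form `1[(1 − κ)θ_i − Δ_i ≤ u^A_i < θ_i]` of §2
`LipProfile.profile_sub_min_le_shell` stays INSIDE `{u^A_i < θ_i}`; `minPiece_profile_mul_le_shell` below is the
per-term statement node U5b instantiates, and the `sibXs` of §3 `LipSlotLedger` is INTENDED in this form (its
docstring says so since v1.2).  Relative form: `Δ_i = ρθ_i` gives the gain `L ρ` and the layer `[(1 − κ − ρ)θ_i, θ_i)`.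
A2.  A LARGE-FIELD slot carries the complementary factor `1 − χ(u/θ)`.  The two runs' complementary factors obey the
same value bound (`abs_one_sub_profile_sub_le`) and the same factorised bound with the core `min`, supported in the
layer `(1 − κ)θ − Δ ≤ u^A < θ + Δ` (`one_sub_profile_sub_min_le_layer`): below it both complementary factors vanish,
above it both equal `1`.  (In a single run the complementary factor is itself a large-field function at the lowered
threshold, §2 `one_sub_profile_le_largeInd`, so such slots may instead be booked by the run's own large-field factor.)
A3.  The `i = j` step of the `χ_k^{(n)}` chain, [Balaban1989LargeFieldI] p. 187 (read as an image by this seat): «On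
the domain Ω_l∖Ω_{l+1}, for l = k₀ + 1,…,j, and on the domain Ω^c_{k₀+1}∖Z″_j for l = k₀, the condition on the
configuration U^{(n)}_{k,Z} is» (1.51) `|U^{(n)}_{k,Z}(∂p) − 1| < (1 − β½)L₀^{2max{0,j−l−1}}ε_j(L^{k−j}η)².` «The
condition on the configuration U^{(n+1)}_{k,Z} has the same form, only j is replaced by j + 1. Introducing this bound
into the inequality (1.48), which holds on those domains with i = j, we obtain» (1.52) `|U^{(n)}_{k,Z}(∂p) − 1| <
(1 − β½)L₀^{2max{0,j−l}}ε_{j+1}(L^{k−j−1}η)²(1 + αβ) + αβε_j(L^{k−j}η)² < ((1 + β₀)(1 + αβ)L₀²/L² + 2αβ/(2 − β))·(1 −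
β½)L₀^{2max{0,j−l−1}}ε_j(L^{k−j}η)².` «The above inequality implies (1.51), under the usual restrictions on β₀, β, L₀
(i.e., β₀ ≤ 1/2, β ≤ 1/2, L₀ < (1/2)L), and α ≤ 1/4. Thus taking α = 1/8 in (1.48) we satisfy all the conditions.»  So
the implied bound for the OLD variable is the OLD threshold (1.51) times the residual factor `slack152 β₀ β α r`,
`r = L₀/L` — at most `113/192` under the printed restrictions (`slack152_le`; `185/384` at the printed `α = 1/8`,
`slack152_le_printed_alpha`), hence this step admits every `κ ≤ 79/192` (`step152_admissible`): never binding against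
§5's `β/10 − (β/5)L^{−2}` and `(3/8)β²2^{−(M+2)}`.  With A3 the chains on the pages pp. 181–187 read by this lineage
are all typed: (1.31) and the rung steps (1.48)–(1.50) in §5, (1.52) here.
[folklore arithmetic about verbatim printed inequalities; no claim that the modified procedure has been carried out] -/

section Advisories

namespace LipProfile

variable {χ : ℝ → ℝ} {κ L : ℝ}

/-- **A1, relative form of the layer bound.**  For `θ > 0` and `|u^A − u^B| ≤ ρθ`:
`χ(u^A/θ) − min(χ(u^A/θ), χ(u^B/θ)) ≤ L ρ · 1[(1 − κ − ρ)θ ≤ u^A < θ]` (the layer has width `(κ + ρ)θ`). [folklore] -/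
theorem profile_sub_min_le_shell_rel (h : LipProfile χ κ L) {θ : ℝ} (hθ : 0 < θ) {uA uB ρ : ℝ}
    (hΔ : |uA - uB| ≤ ρ * θ) :
    χ (uA / θ) - min (χ (uA / θ)) (χ (uB / θ)) ≤ L * ρ * shellBelow uA θ ((κ + ρ) * θ) := by
  have := h.profile_sub_min_le_shell hθ hΔ
  rwa [mul_div_assoc, div_self hθ.ne', mul_one, show κ * θ + ρ * θ = (κ + ρ) * θ by ring] at this

/-- **A2, the value bound for LARGE-FIELD slots.**  For `θ > 0` and `|u^A − u^B| ≤ Δ`: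
`|(1 − χ(u^A/θ)) − (1 − χ(u^B/θ))| ≤ L · Δ/θ`. [folklore] -/
theorem abs_one_sub_profile_sub_le (h : LipProfile χ κ L) {θ : ℝ} (hθ : 0 < θ) {uA uB Δ : ℝ}
    (hΔ : |uA - uB| ≤ Δ) : |(1 - χ (uA / θ)) - (1 - χ (uB / θ))| ≤ L * (Δ / θ) := by
  rw [show (1 - χ (uA / θ)) - (1 - χ (uB / θ)) = χ (uB / θ) - χ (uA / θ) by ring, abs_sub_comm]
  exact h.abs_profile_sub_profile_le hθ hΔ

/-- **A2, the factorised bound for LARGE-FIELD slots.**  For `θ > 0` and `|u^A − u^B| ≤ Δ`: the complementary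
factor's min-piece `(1 − χ(u^A/θ)) − min(1 − χ(u^A/θ), 1 − χ(u^B/θ))` is at most `(L Δ/θ) · 1[u^A ≥ (1 − κ)θ − Δ]`
— the SAME lowered same-run large-field indicator as for small-field slots (below the lowered threshold both
complementary factors vanish). [folklore] -/
theorem one_sub_profile_sub_min_le (h : LipProfile χ κ L) {θ : ℝ} (hθ : 0 < θ) {uA uB Δ : ℝ}
    (hΔ : |uA - uB| ≤ Δ) :
    (1 - χ (uA / θ)) - min (1 - χ (uA / θ)) (1 - χ (uB / θ))
      ≤ L * (Δ / θ) * largeInd uA ((1 - κ) * θ - Δ) := by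
  have hΔ0 : 0 ≤ Δ := (abs_nonneg _).trans hΔ
  unfold largeInd
  split_ifs with hu
  · rw [mul_one]
    rcases le_total (1 - χ (uA / θ)) (1 - χ (uB / θ)) with hle | hle
    · rw [min_eq_left hle, sub_self]
      exact mul_nonneg h.L_pos.le (div_nonneg hΔ0 hθ.le)
    · rw [min_eq_right hle]
      exact (le_abs_self _).trans (h.abs_one_sub_profile_sub_le hθ hΔ)
  · have huA : uA ≤ (1 - κ) * θ := by linarith [not_le.1 hu]
    have huB : uB ≤ (1 - κ) * θ := by
      have h1 := (abs_le.1 hΔ).1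
      linarith [not_le.1 hu]
    rw [h.eq_one (uA / θ) (by rwa [div_le_iff₀ hθ]), h.eq_one (uB / θ) (by rwa [div_le_iff₀ hθ]), sub_self,
      min_self, sub_self, mul_zero]

/-- **A2, layer form.**  … and the large-field slot's min-piece is supported in the LAYER `(1 − κ)θ − Δ ≤ u^A < θ + Δ`
(above `θ + Δ` both runs' tested variables are `≥ θ`, both complementary factors equal `1`, no mismatch):
`≤ (L Δ/θ) · 1[(1 − κ)θ − Δ ≤ u^A < θ + Δ]`, a layer of width `κθ + 2Δ` below `θ + Δ`. [folklore] -/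
theorem one_sub_profile_sub_min_le_layer (h : LipProfile χ κ L) {θ : ℝ} (hθ : 0 < θ) {uA uB Δ : ℝ}
    (hΔ : |uA - uB| ≤ Δ) :
    (1 - χ (uA / θ)) - min (1 - χ (uA / θ)) (1 - χ (uB / θ))
      ≤ L * (Δ / θ) * shellBelow uA (θ + Δ) (κ * θ + 2 * Δ) := by
  by_cases htop : uA < θ + Δ
  · refine (h.one_sub_profile_sub_min_le hθ hΔ).trans (le_of_eq ?_)
    congr 1
    unfold largeInd shellBelow
    have : θ + Δ - (κ * θ + 2 * Δ) = (1 - κ) * θ - Δ := by ring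
    rw [this]
    by_cases hlow : (1 - κ) * θ - Δ ≤ uA <;> simp [hlow, htop]
  · have huA : θ ≤ uA := by linarith [not_lt.1 htop, (abs_nonneg _).trans hΔ]
    have huB : θ ≤ uB := by
      have h1 := (abs_le.1 hΔ).2
      linarith [not_lt.1 htop]
    rw [h.eq_zero (uA / θ) (by rwa [le_div_iff₀ hθ, one_mul]), h.eq_zero (uB / θ) (by rwa [le_div_iff₀ hθ, one_mul]),
      sub_zero, min_self, sub_self]
    exact mul_nonneg (mul_nonneg h.L_pos.le (div_nonneg ((abs_nonneg _).trans hΔ) hθ.le)) (shellBelow_nonneg _ _ _)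

end LipProfile

/-- **A1, PER TERM: the min-piece of a profile family is (level gain) × (SHELL-RESTRICTED sibling).**  As §2
`minPiece_profile_mul_le`, with the lowered large-field indicator sharpened to the layer
`1[(1 − κ)θᵢ − Δᵢ ≤ u^A_i < θᵢ]` — inside the support `{u^A_i < θᵢ}` of the term's own slot-`i` condition, where the
term's remaining factors keep their printed meaning (the form node U5b instantiates; `sibXs` of §3). [folklore] -/
theorem minPiece_profile_mul_le_shell {χ : ℝ → ℝ} {κ L : ℝ} (h : LipProfile χ κ L) {n : ℕ} {uA uB θ Δ : ℕ → ℝ}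
    (hθ : ∀ i < n, 0 < θ i) (hΔ : ∀ i < n, |uA i - uB i| ≤ Δ i) {i : ℕ} (hi : i < n) {R : ℝ} (hR : 0 ≤ R) :
    minPiece (fun i => χ (uA i / θ i)) (fun i => min (χ (uA i / θ i)) (χ (uB i / θ i))) n i * R
      ≤ (L * (Δ i / θ i)) *
        (shellBelow (uA i) (θ i) (κ * θ i + Δ i) * sibling (fun i => χ (uA i / θ i)) n i * R) := by
  have hc : ∀ i < n, 0 ≤ min (χ (uA i / θ i)) (χ (uB i / θ i)) := fun i _ => le_min (h.nonneg _) (h.nonneg _)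
  have hcp : ∀ i < n, min (χ (uA i / θ i)) (χ (uB i / θ i)) ≤ χ (uA i / θ i) := fun i _ => min_le_left _ _
  refine (minPiece_mul_le hc hcp hi hR).trans ?_
  have hsib : 0 ≤ sibling (fun i => χ (uA i / θ i)) n i := sibling_nonneg (fun i _ => h.nonneg _) hi
  calc (χ (uA i / θ i) - min (χ (uA i / θ i)) (χ (uB i / θ i))) * sibling (fun i => χ (uA i / θ i)) n i * R
      ≤ (L * (Δ i / θ i) * shellBelow (uA i) (θ i) (κ * θ i + Δ i))
          * sibling (fun i => χ (uA i / θ i)) n i * R :=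
        mul_le_mul_of_nonneg_right
          (mul_le_mul_of_nonneg_right (h.profile_sub_min_le_shell (hθ i hi) (hΔ i hi)) hsib) hR
    _ = _ := by ring

/-- … the shell-restricted sibling is dominated by the unrestricted one (so every bound through §2
`minPiece_profile_mul_le` remains available): `1[(1 − κ)θ − Δ ≤ u < θ] ≤ 1[u ≥ (1 − κ)θ − Δ]`. [folklore] -/
theorem shellBelow_le_largeInd_lowered (κ θ Δ u : ℝ) :
    shellBelow u θ (κ * θ + Δ) ≤ largeInd u ((1 - κ) * θ - Δ) := by
  unfold shellBelow largeInd
  have : θ - (κ * θ + Δ) = (1 - κ) * θ - Δ := by ring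
  rw [this]
  by_cases hlow : (1 - κ) * θ - Δ ≤ u <;> by_cases htop : u < θ <;> simp [hlow, htop]

/-- The residual factor of the chain (1.52) p. 187 relative to the old condition (1.51):
`(1 + β₀)(1 + αβ)(L₀/L)² + 2αβ/(2 − β)`, verbatim with `r = L₀/L`. (PRINTED SHAPE) [folklore] -/
def slack152 (β₀ β α r : ℝ) : ℝ := (1 + β₀) * (1 + α * β) * r ^ 2 + 2 * α * β / (2 - β)

/-- **(1.52) closes with room to spare.**  Under print's «usual restrictions» `β₀ ≤ 1/2`, `β ≤ 1/2`, `L₀ < ½L`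
(`r ≤ 1/2`) and `α ≤ 1/4` (with `0 ≤ β₀, β, α, r`): `slack152 ≤ (3/2)(9/8)(1/4) + (1/4)(2/3) = 113/192 < 1`.
[folklore] -/
theorem slack152_le {β₀ β α r : ℝ} (hβ₀ : 0 ≤ β₀) (hβ₀' : β₀ ≤ 1 / 2) (hβ : 0 ≤ β) (hβ' : β ≤ 1 / 2)
    (hα : 0 ≤ α) (hα' : α ≤ 1 / 4) (hr : 0 ≤ r) (hr' : r ≤ 1 / 2) : slack152 β₀ β α r ≤ 113 / 192 := by
  unfold slack152
  have h1 : (1 + β₀) * (1 + α * β) * r ^ 2 ≤ 3 / 2 * (9 / 8) * (1 / 4) := by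
    have hab : α * β ≤ 1 / 4 * (1 / 2) := mul_le_mul hα' hβ' hβ (by norm_num)
    have hr2 : r ^ 2 ≤ (1 / 2) ^ 2 := pow_le_pow_left₀ hr hr' 2
    have hA : 0 ≤ 1 + β₀ := by linarith
    have hB : 0 ≤ 1 + α * β := by nlinarith
    calc (1 + β₀) * (1 + α * β) * r ^ 2 ≤ (3 / 2) * (9 / 8) * r ^ 2 := by
          apply mul_le_mul_of_nonneg_right _ (by positivity)
          exact mul_le_mul (by linarith) (by linarith) hB (by norm_num)
      _ ≤ 3 / 2 * (9 / 8) * (1 / 4) := by nlinarith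
  have h2 : 2 * α * β / (2 - β) ≤ 1 / 4 * (2 / 3) := by
    rw [div_le_iff₀ (by linarith)]
    nlinarith [mul_le_mul hα' hβ' hβ (by norm_num : (0:ℝ) ≤ 1 / 4)]
  linarith

/-- … and at the printed choice `α = 1/8`: `slack152 ≤ (3/2)(17/16)(1/4) + (1/8)(2/3) = 185/384`. [folklore] -/
theorem slack152_le_printed_alpha {β₀ β r : ℝ} (hβ₀' : β₀ ≤ 1 / 2) (hβ : 0 ≤ β) (hβ' : β ≤ 1 / 2)
    (hr : 0 ≤ r) (hr' : r ≤ 1 / 2) : slack152 β₀ β 8⁻¹ r ≤ 185 / 384 := by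
  unfold slack152
  have h1 : (1 + β₀) * (1 + 8⁻¹ * β) * r ^ 2 ≤ 3 / 2 * (17 / 16) * (1 / 4) := by
    have hr2 : r ^ 2 ≤ (1 / 2) ^ 2 := pow_le_pow_left₀ hr hr' 2
    have hB : 0 ≤ 1 + 8⁻¹ * β := by positivity
    calc (1 + β₀) * (1 + 8⁻¹ * β) * r ^ 2 ≤ (3 / 2) * (17 / 16) * r ^ 2 := by
          apply mul_le_mul_of_nonneg_right _ (by positivity)
          exact mul_le_mul (by linarith) (by linarith) hB (by norm_num)
      _ ≤ 3 / 2 * (17 / 16) * (1 / 4) := by nlinarith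
  have h2 : 2 * 8⁻¹ * β / (2 - β) ≤ 1 / 8 * (2 / 3) := by
    rw [div_le_iff₀ (by linarith)]
    nlinarith
  linarith

/-- **(1.52) under (η).**  Every `κ ≤ 79/192` puts the chain's implied bound inside the old profile's plateau:
`slack152 ≤ 1 − κ` (under the printed restrictions) — this step never binds against §5. [folklore] -/
theorem step152_admissible {β₀ β α r κ : ℝ} (hβ₀ : 0 ≤ β₀) (hβ₀' : β₀ ≤ 1 / 2) (hβ : 0 ≤ β) (hβ' : β ≤ 1 / 2)
    (hα : 0 ≤ α) (hα' : α ≤ 1 / 4) (hr : 0 ≤ r) (hr' : r ≤ 1 / 2) (hκ : κ ≤ 79 / 192) :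
    slack152 β₀ β α r ≤ 1 - κ := by
  have := slack152_le hβ₀ hβ₀' hβ hβ' hα hα' hr hr'
  linarith

/-- … hence the old function (1.51), as a profile at threshold `θ` (= `(1 − β½)L₀^{2max{0,j−l−1}}ε_j(L^{k−j}η)²`), is
IDENTICALLY `1` wherever the chain (1.52) gives `u ≤ slack152 · θ` (which it does on the support of the new function,
by the upper sandwich §2). [folklore] -/
theorem LipProfile.profile_eq_one_of_step152 {χ : ℝ → ℝ} {κ Lχ : ℝ} (h : LipProfile χ κ Lχ) {β₀ β α r θ u : ℝ}
    (hβ₀ : 0 ≤ β₀) (hβ₀' : β₀ ≤ 1 / 2) (hβ : 0 ≤ β) (hβ' : β ≤ 1 / 2) (hα : 0 ≤ α) (hα' : α ≤ 1 / 4)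
    (hr : 0 ≤ r) (hr' : r ≤ 1 / 2) (hκ : κ ≤ 79 / 192) (hθ : 0 < θ) (hu : u ≤ slack152 β₀ β α r * θ) :
    χ (u / θ) = 1 := by
  refine h.eq_one _ ?_
  rw [div_le_iff₀ hθ]
  exact hu.trans (mul_le_mul_of_nonneg_right (step152_admissible hβ₀ hβ₀' hβ hβ' hα hα' hr hr' hκ) hθ.le)

end Advisories

/-! ## §7 (v1.3) The (η) RE-READ census: the other located «equal to 1» chains, the large-field class, and the one
place where print differentiates a characteristic function

The owner's verdict on design (η) (record `t4/T4-EST-U5bE2.md` v1.3 §5.2(c)) asks for the RE-READ itself: every use of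
a characteristic function on the pages the spine consumes, classified, with one admissibility lemma per «equal to 1»
chain.  This seat read as images [Balaban1989LargeFieldI] §1 pp. 178–202, [Balaban1989LargeFieldII] §1 pp. 356–392 and
[Balaban1988Convergent] pp. 246–256, 265–269, 272–274 (the record `t4/T4-EST-NE7c-P2.md` v1.2 §7 carries the page
census).  The uses fall into classes: P (a decomposition of unity `1 = Σ∏χ∏(1 − χ)` — survives for any profile, since
`χ + (1 − χ) = 1`), U (support ⇒ bound, «the restrictions introduced by … imply» — verbatim, §2 `profile_le_smallInd`),
L (a complementary function yields a large-field factor — at the threshold lowered by `1 − κ`, §2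
`one_sub_profile_le_largeInd`; here `largeField_factor_lowered`, `strictExponent_absorbs`), N («equal to 1» by a
regularity chain — survives iff `κ ≤` the chain's residual slack: §5, §6 A3 and this section), G/E (gauge invariance /
Euclidean covariance of the tested quantity — form-independent), Pos (`χ ≥ 0` used as a density: [Balaban1988Convergent]
(3.29) p. 272 «⟨·⟩_t denotes the expectation value with respect to the probabilistic measure», [Balaban1989LargeFieldII]
p. 380 «the exponential density in the integral is positive» — profiles are `≥ 0`), V (a change of variables or a
normalization substitutes the ARGUMENT of χ — form-independent: [Balaban1988Convergent] p. 269 «These changes of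
variables transform the function χ′_k(S_{k+1}) into the same function, but with V^{(k)} replaced by
V^{(k)}_{Λ^c_{k+1}∩Λ_k}. We use the same notation for the new function. The other characteristic functions are
unchanged.»; [Balaban1989LargeFieldII] p. 391 «the T′_k-operations are normalized»), A (membership in an analyticity
domain, deduced from a U-class bound), I (idempotence `χ² = χ` — NOT LOCATED on any page read) and D (a derivative, an
integration by parts or an interpolation formula falls on χ).
CLASS D IS LOCATED, and only here: [Balaban1988Convergent] p. 272 (3.28) contains «(δ/δA)χ^{(k)}» inside its
`∫₀¹dt⟨…⟩_t` term; p. 273 «Denote the characteristic function with the parameter t multiplying the variables A by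
χ_t^{(k)}. Thus there is the function χ_1^{(k)} in this expression, and χ_0^{(k)} = 1. We have» (3.32)
`log∫dμ_{C^{(k)}(Λ_{k+1})}χ^{(k)} = ∫₀¹dt∫dμ_{C^{(k)}(Λ_{k+1})}(∂/∂t)χ_t^{(k)}(∫dμ_{C^{(k)}(Λ_{k+1})}χ_t^{(k)})^{−1}`
«and (∂/∂t)χ_t^{(k)} can be written as a sum of terms, for which only one characteristic function in the product is
differentiated.»; p. 274 (3.37) carries the factor `∏_{b′∈Λ^{(k)*}_{k+1}, b′≠b}χ^{(k)}(tA(b′))(∂/∂t)χ^{(k)}(tA(b))`.  The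
differentiated function is `χ^{(k)}(Λ_{k+1})` — p. 269 «On the domain Λ_{k+1}, in fact on Λ^~_{k+1} also, there are only
the small field characteristic functions from (3.16) in the integral, their product is χ^{(k)}(Λ_{k+1}).» — the product
of the LITERAL small-FLUCTUATION-field functions (3.16) p. 268 `χ({sup_{b∈(□′^{~2})^{(k)*}}|A_k(b)| < δ_k})`, introduced
because «We want to have characteristic functions depending on the fluctuation field only»; designs (i)/(η) keep
exactly these SHARP (§1 `minPiece_eq_shellPiece_of_indicator`; record v1.1 §6(a): only the BACKGROUND-MEDIATED functions
of the live window are profiled).  So pp. 272–274 stand verbatim under (η); on no page read does a derivative fall on a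
background-mediated function (those are decomposed (P), removed as «equal to 1» (N) or re-argued (V) BEFORE the
fluctuation integral is expanded).  Were one to profile (3.16) as well, the `t`-derivative would fall on a Lipschitz
profile — a bounded difference quotient `≤ L·a/θ`, identically zero while `ta ≤ (1 − κ)θ`
(`LipProfile.abs_profile_tmul_sub_le`, `LipProfile.profile_tmul_eq_one`) — recorded as an advisory, not used.  Print's
own smooth cut-off in the same paper, p. 252: «Here g is a C^∞-function defined on the Lie algebra g, 0 ≤ g(A′) ≤ 1,
g(A′) = 0 on {A′ ∈ g : |A′| ≤ 4/3 g₀^{−1}δ₀}, g(A′) = 1 on {A′ ∈ g : |exp ig₀A′ − 1| ≥ 5/3 δ₀}.» (a relative-width device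
between the thresholds of (1.18) and (1.8); its derivative enters the Jacobian (1.24), never a χ).
THE N-CLASS CHAINS LOCATED BEYOND §5/§6, verbatim, with their residuals (this section's lemmas; `κ` = the profile's
relative width, NOT Bałaban's decay constant κ of [Balaban1989LargeFieldII] (1.66)):
(3.8) [Balaban1988Convergent] p. 266 — the basic scale-ladder step of the profiled function itself ((3.2) p. 265
`χ({sup_{p⊂□′~}|U_{k+1,□′}(∂p) − 1| < ε_{k+1}(L^{−1}η)²})` removes the previous scale's `χ_k`): «|U_{k,□}(∂p) − 1| < (1
+ (2/10)ε_kη)ε_{k+1}(L^{−1}η)² + (2/10)ε_kη²(1 + (4/10)ε_k) < 2(1 + β₀)L^{−2}ε_kη² + (4/10)ε_kη² < ε_kη² for p ⊂ □~.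
Thus χ_k(□) = 1 for □ ⊂ Ω^~_{k+1}.» — factor `slack38 β₀ L = 2(1 + β₀)L^{−2} + 2/5`; admissible `κ ≤ 3/5 − 2(1 +
β₀)L^{−2}` (`step38_admissible`; `4/15` at `β₀ ≤ 1/2`, `L ≥ 3`).
(1.91)∘(1.95) ⇒ (1.96) [Balaban1989LargeFieldI] pp. 198–199: (1.91) `|U″_{k,Z}(∂p) − 1| < |U_{h,□}(V″,∂p) − 1|(1 +
L^{−h}αε_h) + (α + 8α²ε_h)ε_h(L^{k−h}η)²`, (1.95) `|U_{h,□}(V″,∂p) − 1| < |U_{h,□}((1,V_h),∂p) − 1|(1 + L^{−h}αε_h) + (α +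
8α²2ε_h)ε_h(L^{k−h}η)² < ½(1 + L^{−h}αε_h)ε_h(L^{k−h}η)² + (α + 8α²ε_h)ε_h(L^{k−h}η)²`, (1.96) «The estimates (1.91),
(1.95) yield |U″_{k,Z}(∂p) − 1| < ¾ε_h(L^{k−h}η)² < (1 − β(1 − 2^{−(k−h+1)}))ε_h(L^{k−h}η)² for p ⊂ □~, hence on the whole
domain (Ω″^~_{h+1})^c∩Ω_h. We have chosen α = 1/12 in (1.91), (1.94), (1.95).» (p. 198 «We have assumed that β ≤ 1/4») —
composite factor `slack196 α a ε` (`a = L^{−h}αε_h`, `ε = ε_h`, the larger `8α²·2ε_h` line kept): `≤ 11/16` for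
`α ≤ 1/12`, `a, ε ≤ 1/100` (`slack196_le`; print's `< 3/4`: `slack196_lt`); the old threshold is the rung
`rung β (k − h + 1) ≥ 3/4` (`three_quarters_le_rung`); admissible `κ ≤ 1/12` (`step196_admissible`).
(1.98) ibid. p. 200: `|U″_{k,Z}(∂p) − 1| < (2ε_kη² + O(1)B₃B₅M⁵exp(−δdist(p,Λ))ε_kη²)(1 + L^{−j}αε_j)² + (2 +
L^{−j}αε_j)(α + 8α²ε_j)ε_j(L^{k−j}η)² ≤ (2L^{−(k−j)} + 4α + O(1)B₃B₅M⁵exp(−δdist(p,Λ))L^{−(k−j)})ε_j(L^{k−j}η)²`; for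
`j = k`: «hence the last term in the bound (1.98) can be made arbitrarily small for M large enough. Making it smaller
than α, and taking α ≤ 1/8, we estimate the right-hand side of (1.98) by (21/8)ε_kη² ≤ 3(1 − β(1/2))ε_kη² for m = k − 1,
and (21/8)ε_kη² ≤ (1 − β(1/2))L₀^{2(k−m−1)}ε_kη² for the remaining m.» — factor `slack198 α E = 2 + 4α + E`, `E ≤ α`
(`slack198_le`): at the extreme `α = 1/8`, `β = 1/4` the `m = k − 1` comparison `21/8 ≤ 21/8` has ZERO residual
(`slack198_top_residual_zero`; the phenomenon of §5 (1.50)), at print's chosen `α = 1/12` it admits `κ ≤ 5/63`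
(`step198_top_admissible`) — the least residual among this section's chains, still an absolute constant; `m < k − 1`
(`L₀² ≥ 4`) admits `κ ≤ 13/42` (`step198_lower_admissible`); the `Z″` domains, «(4α + O(1)B₃B₅M⁵L₀^{−2(k−j)})ε_j(L^{k−j}η)²
≤ (1 − β)L₀^{2(j−k₀−1)}ε_j(L^{k−j}η)² if O(1)B₃B₅M⁵L₀^{−2(N₀−1)} ≤ 1/4», admit `κ ≤ 2/9` (`step198_mid_admissible`).
The `2δ`-CHAINS: [Balaban1989LargeFieldI] (1.32) + (1.39) + (1.42) pp. 184–185 for the functions (1.8) spend `δ_j + ½δ_j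
+ ½δ_j = 2δ_j` — zero DISPLAYED residual — where both halves are roundings of arbitrarily small terms: p. 185 «hence
the coefficient at δ_j can be arbitrarily small, also after multiplying it by O(1)L from (1.37), if γ is sufficiently
small. We assume that it is so small that the expression on the left-hand side of (1.37) can be bounded by 1/2δ_j.»,
(1.42) `< O(1)B₃exp(−δLM₂R_{j+1})22d²(1 + β₀)(A₀/A₁)δ_j ≤ ½δ_j`; the same shape in [Balaban1988Convergent]: (1.19) p. 250
«|U₁U_{1,□′}^{−1} − 1| < O(1)B₃·exp(−δLM₂R₁)ε₁, and the bound can be made much smaller than δ₀, if M₂R₁ is large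
enough. Thus the second function in the product (1.19) is equal to 1, and we can omit it.», (3.16)–(3.19) p. 268 «The
first is equal to 1, because of the bound on A_k introduced by the second, and the fact that the configuration
V^{(k)}(V_□^{(k)})^{−1} − 1 is small, much smaller than δ_k.» — factor `slack18 τ₁ τ₂ = (1 + τ₁ + τ₂)/2` relative to
`2δ`; admissible `κ ≤ ½ − (τ₁ + τ₂)/2` (`step18_admissible`; print's display `τ₁ = τ₂ = ½` gives the factor `1`,
`slack18_printed`).
FREE-CONSTANT chains: [Balaban1989LargeFieldII] p. 378 «The number M₀ in the definition (1.101) [IV] is not fixed yet;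
we choose it as equal to the above bound, i.e., M₀ = O(1)B₅M⁶. This implies that the characteristic function χ is also
equal to 1.»; [Balaban1988Convergent] p. 248 «it is easy to see that the functions χ₀, χ_{Ax} localized in Ω₁~ are
equal to 1, if A₀ is sufficiently larger than A₁», (3.9) p. 266 «< O(1)δ_k = O(1)(A₁/A₀)ε_k < ε_k … for A₁/A₀
sufficiently small» — `stepFree_admissible` (fix the free constant `(1 − κ)^{−1}` times further inside print's `O(1)`).
L-CLASS: the fundamental factors of [Balaban1989LargeFieldII] pp. 380–383 are Gaussian in the threshold (p. 380
«χ^c_j(P_j), which yields the factor exp(−γ₀(1/(2g_j²))(B₃^{−1}ε_j)²(LM₂R_j)^{−d}|P_j|) in the usual way»; p. 383 as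
quoted in the header); at the lowered threshold the rate carries `(1 − κ)²` (`largeField_factor_lowered`), absorbed by
the free ratios `A₀/A₁`, `γ₀` or by the STRICT exponent inequality «2p₁ − (d + 5)r₀ > p₀» for `g` small
(`strictExponent_absorbs`); the contrapositive chain p. 382 «hence we have |B′(b)| < 12R_j⁴ε + ½δ′_j. If we take ε =
(24R_j⁴)^{−1}δ′_j, then |B′(b)| < δ′_j.» is re-run towards the lowered threshold with `ε = (½ − κ)δ′_j/(12R_j⁴)`
(`step382_choice`), i.e. with the rate `(1 − 2κ)²` (`step382_rate`), `κ < ½`.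
UPSHOT.  Every located N-chain outside the rung ladder keeps an ABSOLUTE-CONSTANT residual (the least, `5/63`, at
print's own `α = 1/12`, `β = 1/4`); the binding admissibility remains §5's rung chain (`κ ≤ (3/8)β·β2^{−(M+2)}` with the
printed constants, `(1 − 8α)β2^{−(M+2)}` with `α` re-chosen), so the species and size of the price — `L_χ =
2^{N+O(1)}/β²` inside `C₀`, header F1 — are unchanged by the re-read; class D touches only sharp-kept functions; class I
does not occur on the pages read.  [folklore arithmetic about verbatim printed inequalities; no claim that the modified
procedure has been carried out] -/

section Chains

/-- The residual factor of the chain (3.8) [Balaban1988Convergent] p. 266, verbatim: `2(1 + β₀)L^{−2} + 4/10` (units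
`ε_kη²`, the OLD threshold of `χ_k`). (PRINTED SHAPE) [folklore] -/
def slack38 (β₀ L : ℝ) : ℝ := 2 * (1 + β₀) * (L ^ 2)⁻¹ + 4 / 10

/-- Print's closing `<` of (3.8), `slack38 < 1`, already for the minimal block size `L ≥ 2` as soon as `β₀ < 1/5`
([Balaban1988Convergent] (2.6) p. 255: «β₀ > 0 can be chosen arbitrarily small, if g is sufficiently small»). [folklore] -/
theorem slack38_lt_one {β₀ L : ℝ} (hβ₀ : 0 ≤ β₀) (hβ₀' : β₀ < 1 / 5) (hL : 2 ≤ L) : slack38 β₀ L < 1 := by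
  unfold slack38
  have hL2 : (L ^ 2)⁻¹ ≤ 4⁻¹ := by
    apply inv_anti₀ (by norm_num)
    nlinarith
  have h1 : 2 * (1 + β₀) * (L ^ 2)⁻¹ ≤ 2 * (1 + β₀) * 4⁻¹ := mul_le_mul_of_nonneg_left hL2 (by positivity)
  nlinarith

/-- **(3.8) under (η).**  `κ ≤ 3/5 − 2(1 + β₀)L^{−2}` puts the chain's implied bound inside the old profile's plateau:
`slack38 β₀ L ≤ 1 − κ`. [folklore] -/
theorem step38_admissible {β₀ L κ : ℝ} (hκ : κ ≤ 3 / 5 - 2 * (1 + β₀) * (L ^ 2)⁻¹) : slack38 β₀ L ≤ 1 - κ := by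
  unfold slack38; linarith

/-- … e.g. every `κ ≤ 4/15` under `β₀ ≤ 1/2`, `L ≥ 3`. [folklore] -/
theorem step38_admissible_of_le {β₀ L κ : ℝ} (hβ₀' : β₀ ≤ 1 / 2) (hL : 3 ≤ L) (hκ : κ ≤ 4 / 15) :
    slack38 β₀ L ≤ 1 - κ := by
  apply step38_admissible
  have hL2 : (L ^ 2)⁻¹ ≤ 9⁻¹ := by
    apply inv_anti₀ (by norm_num)
    nlinarith
  have h1 : 2 * (1 + β₀) * (L ^ 2)⁻¹ ≤ 2 * (3 / 2) * 9⁻¹ :=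
    mul_le_mul (by linarith) hL2 (by positivity) (by positivity)
  linarith

/-- … hence the old function `χ_k(□)`, as a profile at threshold `θ = ε_kη²`, is IDENTICALLY `1` wherever the chain
(3.8) gives `u ≤ slack38 β₀ L · θ`. [folklore] -/
theorem LipProfile.profile_eq_one_of_step38 {χ : ℝ → ℝ} {κ Lχ : ℝ} (h : LipProfile χ κ Lχ) {β₀ L θ u : ℝ}
    (hκ : κ ≤ 3 / 5 - 2 * (1 + β₀) * (L ^ 2)⁻¹) (hθ : 0 < θ) (hu : u ≤ slack38 β₀ L * θ) : χ (u / θ) = 1 := by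
  refine h.eq_one _ ?_
  rw [div_le_iff₀ hθ]
  exact hu.trans (mul_le_mul_of_nonneg_right (step38_admissible hκ) hθ.le)

/-- The composite factor of (1.91)∘(1.95) [Balaban1989LargeFieldI] pp. 198–199 (units `ε_h(L^{k−h}η)²`; `a = L^{−h}αε_h`,
`ε = ε_h`; the larger `8α²·2ε_h` line of (1.95) kept): `(½(1 + a) + (α + 16α²ε))(1 + a) + (α + 8α²ε)`.
(PRINTED SHAPE, composed) [folklore] -/
def slack196 (α a ε : ℝ) : ℝ := (1 / 2 * (1 + a) + (α + 16 * α ^ 2 * ε)) * (1 + a) + (α + 8 * α ^ 2 * ε)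

/-- At `a = ε = 0` the composite is `½ + 2α` (`= 2/3` at print's `α = 1/12`). [folklore] -/
theorem slack196_zero (α : ℝ) : slack196 α 0 0 = 1 / 2 + 2 * α := by unfold slack196; ring

/-- Under `0 ≤ α ≤ 1/12` and the small-parameter bounds `0 ≤ a, ε ≤ 1/100`: `slack196 ≤ 11/16`. [folklore] -/
theorem slack196_le {α a ε : ℝ} (hα : 0 ≤ α) (hα' : α ≤ 1 / 12) (ha : 0 ≤ a) (ha' : a ≤ 1 / 100) (hε : 0 ≤ ε)
    (hε' : ε ≤ 1 / 100) : slack196 α a ε ≤ 11 / 16 := by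
  unfold slack196
  have hα2 : α ^ 2 ≤ (1 / 12) ^ 2 := pow_le_pow_left₀ hα hα' 2
  have hα2e : α ^ 2 * ε ≤ (1 / 12) ^ 2 * (1 / 100) := mul_le_mul hα2 hε' hε (by positivity)
  have hF : 1 / 2 * (1 + a) + (α + 16 * α ^ 2 * ε)
      ≤ 1 / 2 * (1 + 1 / 100) + (1 / 12 + 16 * ((1 / 12) ^ 2 * (1 / 100))) := by linarith
  have hF0 : 0 ≤ 1 / 2 * (1 + a) + (α + 16 * α ^ 2 * ε) := by positivity
  have hprod : (1 / 2 * (1 + a) + (α + 16 * α ^ 2 * ε)) * (1 + a)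
      ≤ (1 / 2 * (1 + 1 / 100) + (1 / 12 + 16 * ((1 / 12) ^ 2 * (1 / 100)))) * (1 + 1 / 100) :=
    mul_le_mul hF (by linarith) (by linarith) (by positivity)
  have hlast : α + 8 * α ^ 2 * ε ≤ 1 / 12 + 8 * ((1 / 12) ^ 2 * (1 / 100)) := by linarith
  have hnum : (1 / 2 * (1 + 1 / 100) + (1 / 12 + 16 * ((1 / 12) ^ 2 * (1 / 100)))) * (1 + 1 / 100)
      + (1 / 12 + 8 * ((1 / 12) ^ 2 * (1 / 100))) ≤ (11 : ℝ) / 16 := by norm_num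
  linarith

/-- Print's own claim in (1.96): the composite is `< 3/4` (under the same small-parameter bounds). [folklore] -/
theorem slack196_lt {α a ε : ℝ} (hα : 0 ≤ α) (hα' : α ≤ 1 / 12) (ha : 0 ≤ a) (ha' : a ≤ 1 / 100) (hε : 0 ≤ ε)
    (hε' : ε ≤ 1 / 100) : slack196 α a ε < 3 / 4 :=
  (slack196_le hα hα' ha ha' hε hε').trans_lt (by norm_num)

/-- The old threshold in (1.96) is the rung `1 − β(1 − 2^{−(k−h+1)})` (§4 `rung β (k − h + 1)`), at least `3/4` for
`β ≤ 1/4` (p. 198 «We have assumed that β ≤ 1/4»). [folklore] -/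
theorem three_quarters_le_rung {β : ℝ} (hβ : 0 ≤ β) (hβ' : β ≤ 1 / 4) (m : ℕ) : 3 / 4 ≤ rung β m := by
  unfold rung
  have h1 : 0 ≤ (2 : ℝ)⁻¹ ^ m := by positivity
  nlinarith [mul_nonneg hβ h1]

/-- **(1.96) under (η).**  Every `κ ≤ 1/12` puts the composite bound inside the old profile's plateau:
`slack196 α a ε ≤ (1 − κ)·rung β m` (`0 ≤ α ≤ 1/12`, `0 ≤ a, ε ≤ 1/100`, `0 ≤ β ≤ 1/4`). [folklore] -/
theorem step196_admissible {α a ε β κ : ℝ} (hα : 0 ≤ α) (hα' : α ≤ 1 / 12) (ha : 0 ≤ a) (ha' : a ≤ 1 / 100)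
    (hε : 0 ≤ ε) (hε' : ε ≤ 1 / 100) (hβ : 0 ≤ β) (hβ' : β ≤ 1 / 4) (hκ : κ ≤ 1 / 12) (m : ℕ) :
    slack196 α a ε ≤ (1 - κ) * rung β m := by
  have h1 := slack196_le hα hα' ha ha' hε hε'
  have h2 := three_quarters_le_rung hβ hβ' m
  have h4 : (1 - κ) * (3 / 4) ≤ (1 - κ) * rung β m := mul_le_mul_of_nonneg_left h2 (by linarith)
  linarith

/-- The factor of (1.98) [Balaban1989LargeFieldI] p. 200 on the domains `Ω_m∖Ω_{m+1}` (`j = k`; units `ε_kη²`):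
`2 + 4α + E`, `E` the exponentially small term («Making it smaller than α»). (PRINTED SHAPE) [folklore] -/
def slack198 (α E : ℝ) : ℝ := 2 + 4 * α + E

/-- Print's estimate: `E ≤ α` gives `slack198 ≤ 2 + 5α` (`21/8` at `α = 1/8`; `29/12` at print's chosen `α = 1/12`).
[folklore] -/
theorem slack198_le {α E : ℝ} (hE : E ≤ α) : slack198 α E ≤ 2 + 5 * α := by unfold slack198; linarith

/-- At the extreme `α = 1/8`, `β = 1/4` the `m = k − 1` comparison of p. 200, `21/8 ≤ 3(1 − β/2) = 21/8`, has ZERO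
residual (cf. §5 `displayed_residual_zero`). [folklore] -/
theorem slack198_top_residual_zero : (3 : ℝ) * (1 - 1 / 4 / 2) - (2 + 5 * (1 / 8)) = 0 := by norm_num

/-- **(1.98), `m = k − 1`, under (η)** at print's chosen `α ≤ 1/12`: every `κ ≤ 5/63` gives
`slack198 α E ≤ (1 − κ)·3(1 − β/2)` (`E ≤ α`, `β ≤ 1/4`). [folklore] -/
theorem step198_top_admissible {α E β κ : ℝ} (hα' : α ≤ 1 / 12) (hE : E ≤ α) (hβ' : β ≤ 1 / 4) (hκ' : κ ≤ 5 / 63) :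
    slack198 α E ≤ (1 - κ) * (3 * (1 - β / 2)) := by
  have h1 : slack198 α E ≤ 29 / 12 := by have := slack198_le hE; linarith
  have h3 : (58 : ℝ) / 63 ≤ 1 - κ := by linarith
  have h4 : (58 : ℝ) / 63 * (3 * (7 / 8)) ≤ (1 - κ) * (3 * (1 - β / 2)) :=
    mul_le_mul h3 (by linarith) (by norm_num) (by linarith)
  linarith

/-- **(1.98), `m < k − 1`, under (η)**: with `s = L₀^{2(k−m−1)} ≥ 4` (`L₀ ≥ 2`), every `κ ≤ 13/42` gives
`slack198 α E ≤ (1 − κ)(1 − β/2)s` (`α ≤ 1/12`, `E ≤ α`, `β ≤ 1/4`). [folklore] -/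
theorem step198_lower_admissible {α E β κ s : ℝ} (hα' : α ≤ 1 / 12) (hE : E ≤ α) (hβ' : β ≤ 1 / 4)
    (hκ' : κ ≤ 13 / 42) (hs : 4 ≤ s) : slack198 α E ≤ (1 - κ) * ((1 - β / 2) * s) := by
  have h1 : slack198 α E ≤ 29 / 12 := by have := slack198_le hE; linarith
  have h2 : (7 : ℝ) / 8 * 4 ≤ (1 - β / 2) * s := mul_le_mul (by linarith) hs (by norm_num) (by linarith)
  have h3 : (29 : ℝ) / 42 ≤ 1 - κ := by linarith
  have h4 : (29 : ℝ) / 42 * (7 / 8 * 4) ≤ (1 - κ) * ((1 - β / 2) * s) := mul_le_mul h3 h2 (by norm_num) (by linarith)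
  linarith

/-- **(1.98) on the `Z″` domains under (η)** (p. 200 «(4α + O(1)B₃B₅M⁵L₀^{−2(k−j)})ε_j(L^{k−j}η)² ≤ (1 −
β)L₀^{2(j−k₀−1)}ε_j(L^{k−j}η)² if O(1)B₃B₅M⁵L₀^{−2(N₀−1)} ≤ 1/4»): with `s = L₀^{2(j−k₀−1)} ≥ 1` and the `O(1)`-term
`E ≤ q s`, `q ≤ 1/4`, every `κ ≤ 2/9` gives `4α + E ≤ (1 − κ)(1 − β)s` (`0 ≤ α ≤ 1/12`, `β ≤ 1/4`). [folklore] -/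
theorem step198_mid_admissible {α E q β κ s : ℝ} (hα : 0 ≤ α) (hα' : α ≤ 1 / 12) (hE : E ≤ q * s) (hq : q ≤ 1 / 4)
    (hβ' : β ≤ 1 / 4) (hκ' : κ ≤ 2 / 9) (hs : 1 ≤ s) : 4 * α + E ≤ (1 - κ) * ((1 - β) * s) := by
  have hs0 : 0 ≤ s := by linarith
  have h0 : 4 * α + E ≤ (4 * α + q) * s := by nlinarith
  have h1 : (4 * α + q) * s ≤ 7 / 12 * s := mul_le_mul_of_nonneg_right (by linarith) hs0
  have h3 : (7 : ℝ) / 9 ≤ 1 - κ := by linarith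
  have h4 : (3 : ℝ) / 4 ≤ 1 - β := by linarith
  have h5 : (7 : ℝ) / 9 * (3 / 4) ≤ (1 - κ) * (1 - β) := mul_le_mul h3 h4 (by norm_num) (by linarith)
  have h6 : 7 / 12 * s ≤ (1 - κ) * (1 - β) * s := mul_le_mul_of_nonneg_right (by linarith) hs0
  calc 4 * α + E ≤ 7 / 12 * s := h0.trans h1
    _ ≤ (1 - κ) * (1 - β) * s := h6
    _ = (1 - κ) * ((1 - β) * s) := by ring

/-- The factor of the `2δ`-threshold chains ((1.8) of [Balaban1989LargeFieldI] via (1.32), (1.39), (1.42) pp. 184–185;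
(1.19) p. 250 and (3.16)–(3.19) p. 268 of [Balaban1988Convergent]) relative to the threshold `2δ`: the tested variable
is at most `δ(1 + τ₁ + τ₂)`, with `τ₁δ`, `τ₂δ` the two small terms that print rounds up to `½δ` each.
(PRINTED SHAPE, normalised) [folklore] -/
def slack18 (τ₁ τ₂ : ℝ) : ℝ := (1 + τ₁ + τ₂) / 2

/-- Print's display `τ₁ = τ₂ = ½` spends the whole threshold: factor `1`, zero displayed residual. [folklore] -/
theorem slack18_printed : slack18 (1 / 2) (1 / 2) = 1 := by unfold slack18; norm_num

/-- **The `2δ`-chains under (η).**  `τ₁ + τ₂ ≤ 1 − 2κ` gives `slack18 τ₁ τ₂ ≤ 1 − κ` — the small terms are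
«arbitrarily small … if γ is sufficiently small» (p. 185), `exp(−δLM₂R_{j+1})`-small ((1.42)), «much smaller than
δ₀, if M₂R₁ is large enough» (p. 250). [folklore] -/
theorem step18_admissible {τ₁ τ₂ κ : ℝ} (h : τ₁ + τ₂ ≤ 1 - 2 * κ) : slack18 τ₁ τ₂ ≤ 1 - κ := by
  unfold slack18; linarith

/-- … e.g. roundings to `¼δ` each admit every `κ ≤ ¼`. [folklore] -/
theorem step18_admissible_quarter {τ₁ τ₂ κ : ℝ} (h₁ : τ₁ ≤ 1 / 4) (h₂ : τ₂ ≤ 1 / 4) (hκ : κ ≤ 1 / 4) :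
    slack18 τ₁ τ₂ ≤ 1 - κ :=
  step18_admissible (by linarith)

/-- … hence the old `2δ`-function, as a profile at threshold `2δ`, is identically `1` wherever the chain gives
`u ≤ δ(1 + τ₁ + τ₂)`. [folklore] -/
theorem LipProfile.profile_eq_one_of_step18 {χ : ℝ → ℝ} {κ Lχ : ℝ} (h : LipProfile χ κ Lχ) {τ₁ τ₂ δ u : ℝ}
    (hτ : τ₁ + τ₂ ≤ 1 - 2 * κ) (hδ : 0 < δ) (hu : u ≤ δ * (1 + τ₁ + τ₂)) : χ (u / (2 * δ)) = 1 := by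
  refine h.eq_one _ ?_
  rw [div_le_iff₀ (by linarith)]
  nlinarith

/-- **FREE-CONSTANT chains under (η)** ([Balaban1989LargeFieldII] p. 378, `M₀`; [Balaban1988Convergent] p. 248 and (3.9)
p. 266, `A₁/A₀`): where print fixes a free threshold constant AT the implied bound `b` (zero displayed residual),
fixing it `(1 − κ)^{−1}` times larger puts `b` inside the profile's plateau `(1 − κ)·threshold`. [folklore] -/
theorem stepFree_admissible {b κ v : ℝ} (hκ : κ < 1) (hv : v ≤ b) : v ≤ (1 - κ) * (b / (1 - κ)) := by
  have h : (1 - κ) * (b / (1 - κ)) = b := by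
    field_simp [(by linarith : (1 - κ) ≠ 0)]
  rw [h]
  exact hv

/-- **L-CLASS under (η): the large-field factor at the lowered threshold.**  A Gaussian large-field factor `exp(−c u²)`
read off a configuration in the support of `1 − χ(u/θ)` — where only `u ≥ (1 − κ)θ` is known (§2
`one_sub_profile_le_largeInd`) instead of print's `u ≥ θ` — is at most `exp(−c(1 − κ)²θ²)`: the printed rate times
`(1 − κ)²`. [folklore] -/
theorem largeField_factor_lowered {c θ κ u : ℝ} (hc : 0 ≤ c) (hκ : κ ≤ 1) (hθ : 0 ≤ θ) (hu : (1 - κ) * θ ≤ u) :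
    Real.exp (-(c * u ^ 2)) ≤ Real.exp (-(c * ((1 - κ) * θ) ^ 2)) := by
  rw [Real.exp_le_exp, neg_le_neg_iff]
  have h0 : 0 ≤ (1 - κ) * θ := mul_nonneg (by linarith) hθ
  exact mul_le_mul_of_nonneg_left (pow_le_pow_left₀ h0 hu 2) hc

/-- **Absorption by a STRICT exponent inequality** ([Balaban1989LargeFieldII] p. 383 «We assume that 2p₁ − (d + 5)r₀ > p₀,
and we estimate the factors by exp(−p₀(g_j))»; likewise the Lipschitz price against `p₀ > r`, header): for real
exponents `b < a`, constants `c > 0`, `c′ ≥ 0` and every `x > 0` with `x ≥ (c′/c)^{1/(a−b)}`: `c′x^b ≤ c x^a` — a rate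
constant degraded by `(1 − κ)²` (or any positive factor) is absorbed for `x = log g^{−2}` large, i.e. for `g ≤ g(κ)`.
[folklore] -/
theorem strictExponent_absorbs {x a b c c' : ℝ} (hc : 0 < c) (hc' : 0 ≤ c') (hab : b < a) (hx : 0 < x)
    (hx' : (c' / c) ^ (1 / (a - b)) ≤ x) : c' * x ^ b ≤ c * x ^ a := by
  have hab' : 0 < a - b := by linarith
  have hq : 0 ≤ c' / c := div_nonneg hc' hc.le
  have h1 : c' / c ≤ x ^ (a - b) := by
    have := Real.rpow_le_rpow (Real.rpow_nonneg hq _) hx' hab'.le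
    rwa [← Real.rpow_mul hq, one_div_mul_cancel hab'.ne', Real.rpow_one] at this
  have h2 : x ^ a = x ^ b * x ^ (a - b) := by
    rw [← Real.rpow_add hx]
    congr 1
    ring
  have hxb : 0 ≤ x ^ b := Real.rpow_nonneg hx.le _
  have h3 : c' = c * (c' / c) := by
    field_simp
  calc c' * x ^ b = c * (c' / c) * x ^ b := by rw [← h3]
    _ ≤ c * x ^ (a - b) * x ^ b := mul_le_mul_of_nonneg_right (mul_le_mul_of_nonneg_left h1 hc.le) hxb
    _ = c * x ^ a := by rw [h2]; ring

/-- **The contrapositive chain p. 382 under (η)** ([Balaban1989LargeFieldII] «hence we have |B′(b)| < 12R_j⁴ε + ½δ′_j.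
If we take ε = (24R_j⁴)^{−1}δ′_j, then |B′(b)| < δ′_j.»): to land below the LOWERED threshold `(1 − κ)δ′_j` take
`ε = (½ − κ)δ′_j/(12R_j⁴)`. [folklore] -/
theorem step382_choice (R4 δ' κ : ℝ) (hR : R4 ≠ 0) :
    12 * R4 * ((1 / 2 - κ) * δ' / (12 * R4)) + δ' / 2 = (1 - κ) * δ' := by
  have h : 12 * R4 * ((1 / 2 - κ) * δ' / (12 * R4)) = (1 / 2 - κ) * δ' := by
    field_simp
  rw [h]
  ring

/-- … and the Wilson-action rate `ε²` becomes `(1 − 2κ)²` times the printed `((24R_j⁴)^{−1}δ′_j)²` (`κ < ½`). [folklore] -/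
theorem step382_rate (R4 δ' κ : ℝ) :
    ((1 / 2 - κ) * δ' / (12 * R4)) ^ 2 = (1 - 2 * κ) ^ 2 * (δ' / (24 * R4)) ^ 2 := by
  rw [div_pow, div_pow, mul_pow, mul_pow, mul_pow]
  ring

namespace LipProfile

variable {χ : ℝ → ℝ} {κ L : ℝ}

/-- **CLASS D advisory (not used by (η) as designed).**  Along the interpolation `t ↦ χ(t·a/θ)` of
[Balaban1988Convergent] (3.32)/(3.37) a Lipschitz profile has difference quotients bounded by `L·a/θ`:
`|χ(ta/θ) − χ(sa/θ)| ≤ L(a/θ)|t − s|` (`a ≥ 0` the tested variable, `θ > 0` the threshold). [folklore] -/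
theorem abs_profile_tmul_sub_le (h : LipProfile χ κ L) {θ : ℝ} (hθ : 0 < θ) {a : ℝ} (ha : 0 ≤ a) (t s : ℝ) :
    |χ (t * a / θ) - χ (s * a / θ)| ≤ L * (a / θ) * |t - s| := by
  have hΔ : |t * a - s * a| ≤ |t - s| * a := by
    rw [← sub_mul, abs_mul, abs_of_nonneg ha]
  have := h.abs_profile_sub_profile_le hθ hΔ
  calc |χ (t * a / θ) - χ (s * a / θ)| ≤ L * (|t - s| * a / θ) := this
    _ = L * (a / θ) * |t - s| := by ring

/-- … it is CONSTANT `= 1` as long as `ta ≤ (1 − κ)θ` … [folklore] -/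
theorem profile_tmul_eq_one (h : LipProfile χ κ L) {θ : ℝ} (hθ : 0 < θ) {a t : ℝ} (hta : t * a ≤ (1 - κ) * θ) :
    χ (t * a / θ) = 1 :=
  h.eq_one _ (by rwa [div_le_iff₀ hθ])

/-- … and CONSTANT `= 0` once `ta ≥ θ`: so the `t`-derivative of a profiled factor would be a bounded density supported in
`{(1 − κ)θ ≤ ta ≤ θ}`, where the lowered large-field bound on `a` is at hand. [folklore] -/
theorem profile_tmul_eq_zero (h : LipProfile χ κ L) {θ : ℝ} (hθ : 0 < θ) {a t : ℝ} (hta : θ ≤ t * a) :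
    χ (t * a / θ) = 0 :=
  h.eq_zero _ (by rwa [le_div_iff₀ hθ, one_mul])

end LipProfile

end Chains

end Literature.MathematicalPhysics.QuantumFieldTheory.Balaban1983to89.T4LipschitzCutoff

end
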